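import Literature.MathematicalPhysics.QuantumLattice.XYOrderInfraredProofs
import Literature.MathematicalPhysics.QuantumLattice.XYOrderRiemannSumProofs
import Literature.MathematicalPhysics.QuantumLattice.GroundStateSourceBounds
import Literature.MathematicalPhysics.QuantumLattice.SpinEmbedding
import Literature.MathematicalPhysics.QuantumLattice.HubbardGrandCanonicalParticleHole
import Literature.MathematicalPhysics.QuantumLattice.XXZGraphAutomorphism
import Literature.MathematicalPhysics.QuantumLattice.RectTorusInteractionBounds
import Mathlib.Algebra.QuadraticDiscriminant
import HarnessLib

/-!
# Stability transfer for the spin-½ quantum XY model on `ℤ²`: tracial ground-state LRO from a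
# mean Gaussian-domination hypothesis, uniformly over small `U(1)`-symmetric finite-range perturbations

Kennedy–Lieb–Shastry (J. Stat. Phys. 53 (1988) 1019; PRL 61 (1988) 2582) prove `xy` long-range order
in the ground state of the spin-½ XY model on `ℤ²` from (GD) Gaussian domination (reflection
positivity), (13) the double-commutator identity, Kubo's `|e₃| ≤ e₁`, the sum rule and `e₁ ≥ ⅛`.
Reflection positivity — hence (GD) — is destroyed by a generic perturbation `W`. This file isolates
EXACTLY what of (GD) the KLS argument consumes and proves the rest for the perturbed model
`H'_L = H_L + W_L`, `W_L = Σ_v τ_v w` (translates of one Hermitian, `U(1)`-invariant, real,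
swap-symmetric rule `w` supported in the box `[0,R)²`, `‖w‖ ≤ ε` — the class `AdmissibleWsym ε R`):

* `MeanGDn 𝒲 κ` — the KLS-WEIGHTED ZONE AVERAGE of the Gaussian-domination ratio is `≤ 1 + κ`
  (weights `F₂(p_q)/E_q`; a DEFINITION, the hypothesis; at `W = 0` it holds with `κ = 0` by (GD));
  `UniformMeanGDn κ` — the same for all `𝒲 : AdmissibleWsym ε₁ R` with some `ε₁ = ε₁(R) > 0`.
* `TracialLRO 𝒲 c L₀` — `xy` long-range order `Re ω'_L(Σ_{x,y}(S¹_xS¹_y + S²_xS²_y)) ≥ c L⁴` in the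
  TRACIAL ground state `ω'_L = Tr(P₀ ·)/Tr P₀` of `H'_L` on even tori `L ≥ L₀`.
* **Main theorem** `tracialLRO_of_uniformMeanGDn`: for `0 ≤ κ < klsKappa₀ := 1/(2 I(2)²) − 1`
  (`I(2)` = the KLS integral `klsIntegral 2` of the tree; `klsKappa₀ ≈ 0.195`, certified in-tree
  `≥ π²/9 − 1`), `UniformMeanGDn κ` implies: for every range `R` there are `ε₀ > 0`, `c > 0`, `L₀`
  with `TracialLRO 𝒲 c L₀` for EVERY `𝒲 : AdmissibleWsym ε₀ R`. The transfer itself,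
  `klsTransferJn : KLSTransferJnAt klsKappa₀`, is UNCONDITIONAL.

Ingredients, all PROVED here over the tree's KLS vocabulary (`XYOrderProofs`, `XYOrderInfraredProofs`,
`XYOrderDischarges`, `XYOrderRiemannSumProofs`): Part A `weighted_secondOrderPT` (second-order
perturbation theory done variationally for a weighted family of centred perturbations — the `t → 0`
germ of an averaged Gaussian-domination hypothesis); Part B `kls_modeSum_le_of_quadForm` (the KLS
mode sum bounded directly from the weighted quadratic form by ONE Lagrange multiplier); Part C the
perturbed analogues of KLS's finite-volume facts in the tracial state of `H'_L`: F1 centring of the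
one-modes (translation invariance), F3a the state-generic double commutator of `H_L` (KLS eq. (13)),
F3b `|Re ω'([C_q,[W_L,C_q]] + [D_q,[W_L,D_q]])| ≤ 2R⁴ε|Λ|` (locality), F3c/F3d the `U(1)` quarter
turn and the axis swap, F3e Kubo's `|e'₃| ≤ e'₁ + ε` on even tori (Kubo's two rotations in the
perturbed state), F5 `e'₁ ≥ ⅛ − ε/2` (variational principle), and the bookkeeping
`quadForm_of_meanGDn`, `beta_le`, `kls_ineq7_state`, `klsTransferJn`.

What is NOT here (deliberately): no claim that `UniformMeanGDn κ` holds for any `κ < klsKappa₀`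
when `W ≠ 0` — that is the open problem («E*»: stability of the XY ground-state order under
non-reflection-positive perturbations; Kennedy–Lieb–Shastry 1988 is `W = 0`); accordingly the
conclusion «tracial LRO uniformly over `AdmissibleWsym ε₀ R`» is NOT given a closed `Prop` name
(conjectures are not Literature) — it is the explicit conclusion of the conditional theorem, and a
consumer takes `UniformMeanGDn κ` as its ONE named hypothesis. Per-vector (non-tracial) LRO under
ground-state degeneracy is not reachable by the tracial chain and is not claimed. NOVELTY NOTE: the
device of optimising the KLS sum-rule weight over on-site + nearest-neighbour correlation functions
is PRINTED — Wischmann & Müller-Hartmann, J. Phys. I 1 (1991) 647, §2 eq. (8), Table I; the only new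
bookkeeping here is the `κ`-parametrisation of the threshold and the perturbed (`W ≠ 0`) setting.
The locality kit of §C.1e is copied from the summit-side treatment of KLS eq. (13) for local rule
sums (route AposterioriCapRg, `stub_doubleCommutatorW`), where it is `private`.

Provenance: written in the ideation cell `xylro-ideate` (HOME `run/shared/lean/pub/xylro-ideate/`,
memos `ROUTE-P2-g5.md`, `W-P2/README.md`); planner P2 g2–g5 (Parts A–C, F1/F3a/F3c/F3d/F5,
bookkeeping), literature seat g10 (F3b, F3e, this landing).

## References
* T. Kennedy, E. H. Lieb, B. S. Shastry, *The XY model has long-range order for all spins and all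
  dimensions greater than one*, J. Stat. Phys. 53 (1988) 1019–1030 [KLS1988JSP], eqs. (12)–(14).
* T. Kennedy, E. H. Lieb, B. S. Shastry, *Existence of Néel order in some spin-½ Heisenberg
  antiferromagnets*, PRL 61 (1988) 2582–2584 [KLS1988PRL], eqs. (3)–(8).
* K. Kubo, PRL 61 (1988) 110 [Kubo1988PRL] (the `1 ↔ 3` interchange).
* F. J. Dyson, E. H. Lieb, B. Simon, J. Stat. Phys. 18 (1978) 335 [DysonLiebSimon1978] (Gaussian
  domination; sublattice rotations).
* H.-A. Wischmann, E. Müller-Hartmann, J. Phys. I 1 (1991) 647 [WischmannMullerhartmann1991], §2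
  eq. (8) (optimised sum-rule weights).
* H. Tasaki, *Physics and Mathematics of Quantum Many-Body Systems* (2020), §2.1–2.4 [Tasaki2020].
-/

noncomputable section

open Matrix Finset Filter Topology
open scoped ComplexOrder Matrix.Norms.L2Operator
open Literature.MathematicalPhysics.QuantumLattice

namespace Literature.MathematicalPhysics.QuantumLattice.XYStabilityTransfer

variable {m : Type*} [Fintype m] [DecidableEq m]

/-- `tr(P₀ O)` real part (un-normalised tracial ground-state expectation). [folklore] -/
def trP (H O : Matrix m m ℂ) : ℝ := (H.groundProj * O).trace.re

/-- `Re ω_H(O) = (tr P₀)⁻¹ tr(P₀ O)` (real parts). [folklore] -/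
private theorem re_groundStateFunctional_eq_trP [Nonempty m] {H : Matrix m m ℂ} (hH : H.IsHermitian)
    (O : Matrix m m ℂ) :
    (H.groundStateFunctional O).re = (H.groundProj.trace.re)⁻¹ * trP H O := by
  have hm_im : H.groundProj.trace.im = 0 :=
    (Complex.pos_iff.mp (trace_groundProj_pos hH)).2.symm
  have htrP : H.groundProj.trace = (H.groundProj.trace.re : ℂ) :=
    Complex.ext (by simp) (by simp [hm_im])
  rw [groundStateFunctional_apply, htrP, ← Complex.ofReal_inv, Complex.re_ofReal_mul, trP,
    Complex.ofReal_re]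

/-- `tr(P₀ V²) ≥ 0` for Hermitian `V`. [folklore] -/
private theorem trP_mul_self_nonneg [Nonempty m] {H V : Matrix m m ℂ} (hH : H.IsHermitian)
    (hV : V.IsHermitian) : 0 ≤ trP H (V * V) := by
  have hm : 0 < H.groundProj.trace.re := (Complex.pos_iff.mp (trace_groundProj_pos hH)).1
  have h := re_groundStateFunctional_mul_self_nonneg H hV
  rw [re_groundStateFunctional_eq_trP hH] at h
  exact (mul_nonneg_iff_of_pos_left (inv_pos.2 hm)).1 h

/-- The trace expansion of the trial projection `Φ = (1 + sV)P₀` against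
`M = (H − E₀) + tV + c·1` (verbatim the computation inside the tree's
`Matrix.groundState_infraredBound_quadratic`, with a free scalar `c`). [folklore] -/
private theorem trace_trial_expansion {P K V : Matrix m m ℂ} (hPh : Pᴴ = P) (hPP : P * P = P)
    (hKP : K * P = 0) (hPK : P * K = 0) (hV : V.IsHermitian) (t s c : ℝ) :
    ((P + (s : ℂ) • (V * P))ᴴ * (K + (t : ℂ) • V + (c : ℂ) • (1 : Matrix m m ℂ)) *
        (P + (s : ℂ) • (V * P))).trace =
      (t : ℂ) * (P * V).trace + (c : ℂ) * P.trace +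
        ((2 * s : ℝ) : ℂ) * ((t : ℂ) * (P * (V * V)).trace + (c : ℂ) * (P * V).trace) +
        ((s ^ 2 : ℝ) : ℂ) * ((P * (V * K * V)).trace + (t : ℂ) * (P * (V * V * V)).trace +
          (c : ℂ) * (P * (V * V)).trace) := by
  set M : Matrix m m ℂ := K + (t : ℂ) • V + (c : ℂ) • 1 with hM_def
  set Φ : Matrix m m ℂ := P + (s : ℂ) • (V * P) with hΦ
  have hΦh : Φᴴ = P + (s : ℂ) • (P * V) := by
    rw [hΦ, conjTranspose_add, conjTranspose_smul, conjTranspose_mul, hPh, hV.eq,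
      Complex.star_def, Complex.conj_ofReal]
  have hΦΦ : Φ * Φᴴ =
      P + (s : ℂ) • (P * V) + (s : ℂ) • (V * P) + ((s : ℂ) * (s : ℂ)) • (V * P * V) := by
    have e1 : P * ((s : ℂ) • (P * V)) = (s : ℂ) • (P * V) := by
      rw [Matrix.mul_smul, ← mul_assoc, hPP]
    have e2 : (s : ℂ) • (V * P) * P = (s : ℂ) • (V * P) := by
      rw [Matrix.smul_mul, mul_assoc, hPP]
    have e3 : (s : ℂ) • (V * P) * ((s : ℂ) • (P * V)) = ((s : ℂ) * (s : ℂ)) • (V * P * V) := by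
      rw [Matrix.smul_mul, Matrix.mul_smul, smul_smul, ← mul_assoc (V * P) P V, mul_assoc V P P,
        hPP]
    rw [hΦh, hΦ, add_mul, mul_add, mul_add, hPP, e1, e2, e3]
    abel
  have h1 : (P * M).trace = (t : ℂ) * (P * V).trace + (c : ℂ) * P.trace := by
    rw [hM_def, mul_add, mul_add, hPK, zero_add, trace_add, Matrix.mul_smul, trace_smul,
      Matrix.mul_smul, mul_one, trace_smul, smul_eq_mul, smul_eq_mul]
  have h2 : (P * V * M).trace = (t : ℂ) * (P * (V * V)).trace + (c : ℂ) * (P * V).trace := by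
    have hz : (P * V * K).trace = 0 := by
      rw [mul_assoc, trace_mul_cycle', ← mul_assoc, hKP, zero_mul, trace_zero]
    rw [hM_def, mul_add, mul_add, trace_add, trace_add, Matrix.mul_smul, trace_smul,
      Matrix.mul_smul, mul_one, trace_smul, smul_eq_mul, smul_eq_mul, hz, zero_add, mul_assoc]
  have h3 : (V * P * M).trace = (t : ℂ) * (P * (V * V)).trace + (c : ℂ) * (P * V).trace := by
    have hz : (V * P * K).trace = 0 := by rw [mul_assoc, hPK, mul_zero, trace_zero]
    have hy : (V * P * V).trace = (P * (V * V)).trace := by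
      rw [trace_mul_cycle, trace_mul_comm (V * V) P]
    have hx : (V * P).trace = (P * V).trace := trace_mul_comm V P
    rw [hM_def, mul_add, mul_add, trace_add, trace_add, Matrix.mul_smul, trace_smul,
      Matrix.mul_smul, mul_one, trace_smul, smul_eq_mul, smul_eq_mul, hz, zero_add, hy, hx]
  have h4 : (V * P * V * M).trace = (P * (V * K * V)).trace +
      (t : ℂ) * (P * (V * V * V)).trace + (c : ℂ) * (P * (V * V)).trace := by
    have hx : (V * P * V * K).trace = (P * (V * K * V)).trace := by
      rw [mul_assoc (V * P) V K, trace_mul_comm (V * P) (V * K), ← mul_assoc,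
        trace_mul_cycle (V * K) V P, mul_assoc P (V * K) V]
    have hy : (V * P * V * V).trace = (P * (V * V * V)).trace := by
      rw [mul_assoc (V * P) V V, trace_mul_comm (V * P) (V * V), ← mul_assoc,
        trace_mul_cycle (V * V) V P, mul_assoc P (V * V) V]
    have hw : (V * P * V).trace = (P * (V * V)).trace := by
      rw [trace_mul_cycle, trace_mul_comm (V * V) P]
    rw [hM_def, mul_add, mul_add, trace_add, trace_add, Matrix.mul_smul, trace_smul,
      Matrix.mul_smul, mul_one, trace_smul, smul_eq_mul, smul_eq_mul, hx, hy, hw]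
  rw [trace_mul_cycle, hΦΦ, add_mul, add_mul, add_mul, trace_add, trace_add, trace_add,
    Matrix.smul_mul, Matrix.smul_mul, Matrix.smul_mul, trace_smul, trace_smul, trace_smul,
    smul_eq_mul, smul_eq_mul, smul_eq_mul, h1, h2, h3, h4]
  push_cast
  ring

/-- **The one-mode trial inequality** (Rayleigh quotient of `(1 + sV)P₀` for `H + tV`, centred
mode `Re ω(V) = 0`, and the a-priori bound `E₀(H + tV) ≥ E₀(H) − |t|‖V‖`):
`tr P₀ · (E₀(H+tV) − E₀(H)) ≤ 2st·tr(P₀V²) + s²(tr(P₀VKV) + t·tr(P₀V³)) + |t|‖V‖ s² tr(P₀V²)`. [folklore] -/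
private theorem trial_ineq [Nonempty m] {H V : Matrix m m ℂ} (hH : H.IsHermitian) (hV : V.IsHermitian)
    (h1 : (H.groundStateFunctional V).re = 0) (t s : ℝ) :
    H.groundProj.trace.re * ((H + (t : ℂ) • V).groundEnergy - H.groundEnergy) ≤
      2 * s * t * trP H (V * V) +
        s ^ 2 * (trP H (V * (H - (H.groundEnergy : ℂ) • 1) * V) + t * trP H (V * V * V)) +
        |t| * ‖V‖ * (s ^ 2 * trP H (V * V)) := by
  set P := H.groundProj with hP_def
  set K : Matrix m m ℂ := H - (H.groundEnergy : ℂ) • 1 with hK_def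
  have hPh : Pᴴ = P := (groundProj_isHermitian H).eq
  have hPP : P * P = P := groundProj_mul_self H
  have hKP : K * P = 0 := sub_groundEnergy_mul_groundProj H
  have hPK : P * K = 0 := groundProj_mul_sub_groundEnergy hH
  set mR : ℝ := P.trace.re with hmR
  set v₁ : ℝ := (P * V).trace.re with hv₁
  set a : ℝ := (P * (V * V)).trace.re with ha
  set b : ℝ := (P * (V * K * V)).trace.re with hb
  set c₃ : ℝ := (P * (V * V * V)).trace.re with hc₃
  have hm : 0 < mR := (Complex.pos_iff.mp (trace_groundProj_pos hH)).1
  -- centring: `v₁ = 0`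
  have hv0 : v₁ = 0 := by
    have h := re_groundStateFunctional_eq_trP hH V
    rw [h1] at h
    have h' : mR⁻¹ * v₁ = 0 := by rw [hv₁]; exact h.symm
    rcases mul_eq_zero.1 h' with h'' | h''
    · exact absurd h'' (inv_ne_zero hm.ne')
    · exact h''
  -- Step 0: `M = K + tV + c·1 ≥ 0`, `c = E₀(H) − E₀(H + tV)`
  set c : ℝ := H.groundEnergy - (H + (t : ℂ) • V).groundEnergy with hc_def
  have hX : (H + (t : ℂ) • V).IsHermitian := hH.add (hV.ofReal_smul t)
  have hM : (K + (t : ℂ) • V + (c : ℂ) • (1 : Matrix m m ℂ)).PosSemidef := by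
    have h := posSemidef_sub_of_groundEnergy_le hX (le_refl (H + (t : ℂ) • V).groundEnergy)
    convert h using 1
    rw [hK_def, hc_def, Complex.ofReal_sub, sub_smul]
    abel
  -- Step 1/2: the trace inequality
  have hineq : 0 ≤ t * v₁ + c * mR + (2 * s) * (t * a + c * v₁) +
      s ^ 2 * (b + t * c₃ + c * a) := by
    have hpsd := hM.conjTranspose_mul_mul_same (P + (s : ℂ) • (V * P))
    have h0 := hpsd.trace_re_nonneg
    rw [trace_trial_expansion hPh hPP hKP hPK hV t s c] at h0
    simpa only [Complex.add_re, Complex.re_ofReal_mul, ← hmR, ← hv₁, ← ha, ← hb, ← hc₃] using h0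
  -- Step 3: a priori `c ≤ |t| ‖V‖`
  have hcle : c ≤ |t| * ‖V‖ := by
    have key := Matrix.groundEnergy_le_groundStateFunctional_re hX hH
    have e0 : (H + (t : ℂ) • V).groundStateFunctional H =
        (H + (t : ℂ) • V).groundStateFunctional (H + (t : ℂ) • V) -
          (t : ℂ) * (H + (t : ℂ) • V).groundStateFunctional V := by
      rw [← smul_eq_mul, ← LinearMap.map_smul, ← map_sub, add_sub_cancel_right]
    have e1 : ((H + (t : ℂ) • V).groundStateFunctional H).re =
        (H + (t : ℂ) • V).groundEnergy - t * ((H + (t : ℂ) • V).groundStateFunctional V).re := by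
      rw [e0, Matrix.groundStateFunctional_hamiltonian hX, Complex.sub_re, Complex.ofReal_re,
        Complex.re_ofReal_mul]
    rw [e1] at key
    have hn := abs_re_groundStateFunctional_le_norm hX V
    have h2 : -(t * ((H + (t : ℂ) • V).groundStateFunctional V).re) ≤ |t| * ‖V‖ := by
      calc -(t * ((H + (t : ℂ) • V).groundStateFunctional V).re)
          ≤ |t * ((H + (t : ℂ) • V).groundStateFunctional V).re| := neg_le_abs _
        _ = |t| * |((H + (t : ℂ) • V).groundStateFunctional V).re| := abs_mul _ _
        _ ≤ |t| * ‖V‖ := mul_le_mul_of_nonneg_left hn (abs_nonneg t)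
    rw [hc_def]
    linarith
  -- Step 4: combine
  have ha0 : 0 ≤ a := trP_mul_self_nonneg hH hV
  have hca : c * (s ^ 2 * a) ≤ |t| * ‖V‖ * (s ^ 2 * a) :=
    mul_le_mul_of_nonneg_right hcle (by positivity)
  have hgoal : (H + (t : ℂ) • V).groundEnergy - H.groundEnergy = -c := by rw [hc_def]; ring
  rw [hv0] at hineq
  show mR * ((H + (t : ℂ) • V).groundEnergy - H.groundEnergy) ≤
    2 * s * t * a + s ^ 2 * (b + t * c₃) + |t| * ‖V‖ * (s ^ 2 * a)
  rw [hgoal]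
  nlinarith [hineq, hca]

/-- Elementary: `0 ≤ X + tG` for all small `t > 0` (`G ≥ 0`) forces `0 ≤ X`. [folklore] -/
private theorem nonneg_of_forall_small {X G δ : ℝ} (hδ : 0 < δ) (hG : 0 ≤ G)
    (h : ∀ t : ℝ, 0 < t → t < δ → 0 ≤ X + t * G) : 0 ≤ X := by
  by_contra hX
  push Not at hX
  have hG1 : 0 < G + 1 := by linarith
  set t := min (δ / 2) (-X / (2 * (G + 1))) with ht
  have ht0 : 0 < t := lt_min (by linarith) (div_pos (by linarith) (by linarith))
  have htδ : t < δ := (min_le_left _ _).trans_lt (by linarith)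
  have htX : t ≤ -X / (2 * (G + 1)) := min_le_right _ _
  have h1 : t * G ≤ -X / (2 * (G + 1)) * G := mul_le_mul_of_nonneg_right htX hG
  have h2 : -X / (2 * (G + 1)) * G ≤ -X / 2 := by
    rw [div_mul_eq_mul_div, div_le_iff₀ (by linarith)]
    nlinarith
  have := h t ht0 htδ
  linarith

/-- **Part A. Weighted second-order perturbation theory, variationally.**
`H` Hermitian, `V_i` Hermitian and CENTRED (`Re ω(V_i) = 0`), weights `w_i ≥ 0`. If for all
small `|t|` the weighted Gaussian-domination inequality
`Σ_i w_i (E₀(H) − E₀(H + tV_i)) ≤ ½ γ t² Σ_i w_i Q_i` holds, then for EVERY choice of real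
multipliers `μ_i`,
`0 ≤ Σ_i w_i (½ γ Q_i + 2 μ_i Re ω(V_i²) + μ_i² Re ω(V_i (H − E₀) V_i))`. [cite: KLS1988JSP, eqs. (14), (19)] -/
theorem weighted_secondOrderPT [Nonempty m] {H : Matrix m m ℂ} (hH : H.IsHermitian)
    {ι : Type*} (s : Finset ι) {V : ι → Matrix m m ℂ} (hV : ∀ i ∈ s, (V i).IsHermitian)
    {w Q : ι → ℝ} (hw : ∀ i ∈ s, 0 ≤ w i) {γ : ℝ}
    (h1 : ∀ i ∈ s, (H.groundStateFunctional (V i)).re = 0)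
    (hGD : ∃ δ > 0, ∀ t : ℝ, |t| < δ →
      ∑ i ∈ s, w i * (H.groundEnergy - (H + (t : ℂ) • V i).groundEnergy) ≤
        γ / 2 * t ^ 2 * ∑ i ∈ s, w i * Q i)
    (μ : ι → ℝ) :
    0 ≤ ∑ i ∈ s, w i * (γ * Q i / 2 + 2 * μ i * (H.groundStateFunctional (V i * V i)).re +
      μ i ^ 2 * (H.groundStateFunctional (V i * (H - (H.groundEnergy : ℂ) • 1) * V i)).re) := by
  obtain ⟨δ, hδ, hGD⟩ := hGD
  set K : Matrix m m ℂ := H - (H.groundEnergy : ℂ) • 1 with hK_def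
  set mR : ℝ := H.groundProj.trace.re with hmR
  have hm : 0 < mR := (Complex.pos_iff.mp (trace_groundProj_pos hH)).1
  have ha0 : ∀ i ∈ s, 0 ≤ trP H (V i * V i) := fun i hi => trP_mul_self_nonneg hH (hV i hi)
  -- the two constants of the limiting argument
  set S : ℝ := ∑ i ∈ s, w i * (2 * μ i * trP H (V i * V i) + μ i ^ 2 * trP H (V i * K * V i))
    with hS
  set X : ℝ := mR * (γ / 2 * ∑ i ∈ s, w i * Q i) + S with hX
  set G : ℝ := ∑ i ∈ s, w i * (μ i ^ 2 * (|trP H (V i * V i * V i)| + ‖V i‖ * trP H (V i * V i)))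
    with hG
  have hG0 : 0 ≤ G := by
    refine sum_nonneg fun i hi => mul_nonneg (hw i hi) (mul_nonneg (sq_nonneg _) ?_)
    exact add_nonneg (abs_nonneg _) (mul_nonneg (norm_nonneg _) (ha0 i hi))
  have key : ∀ t : ℝ, 0 < t → t < δ → 0 ≤ X + t * G := by
    intro t ht0 htδ
    have hGDt := hGD t (by rwa [abs_of_pos ht0])
    -- per mode, trial parameter `s = t μ_i`
    have hmode : ∀ i ∈ s, mR * ((H + (t : ℂ) • V i).groundEnergy - H.groundEnergy) ≤
        t ^ 2 * (2 * μ i * trP H (V i * V i) + μ i ^ 2 * trP H (V i * K * V i)) +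
          t ^ 3 * (μ i ^ 2 * (|trP H (V i * V i * V i)| + ‖V i‖ * trP H (V i * V i))) := by
      intro i hi
      have h := trial_ineq hH (hV i hi) (h1 i hi) t (t * μ i)
      rw [abs_of_pos ht0] at h
      have h3 : 0 ≤ t ^ 3 * μ i ^ 2 * (|trP H (V i * V i * V i)| - trP H (V i * V i * V i)) := by
        have : 0 ≤ |trP H (V i * V i * V i)| - trP H (V i * V i * V i) := by
          linarith [le_abs_self (trP H (V i * V i * V i))]
        positivity
      have e : t ^ 2 * (2 * μ i * trP H (V i * V i) + μ i ^ 2 * trP H (V i * K * V i)) +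
          t ^ 3 * (μ i ^ 2 * (|trP H (V i * V i * V i)| + ‖V i‖ * trP H (V i * V i))) -
          (2 * (t * μ i) * t * trP H (V i * V i) +
            (t * μ i) ^ 2 * (trP H (V i * K * V i) + t * trP H (V i * V i * V i)) +
            t * ‖V i‖ * ((t * μ i) ^ 2 * trP H (V i * V i))) =
          t ^ 3 * μ i ^ 2 * (|trP H (V i * V i * V i)| - trP H (V i * V i * V i)) := by ring
      linarith [h, h3, e]
    have hsum : mR * ∑ i ∈ s, w i * ((H + (t : ℂ) • V i).groundEnergy - H.groundEnergy) ≤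
        t ^ 2 * S + t ^ 3 * G := by
      rw [hS, hG, mul_sum, mul_sum, mul_sum, ← sum_add_distrib]
      refine sum_le_sum fun i hi => ?_
      calc mR * (w i * ((H + (t : ℂ) • V i).groundEnergy - H.groundEnergy))
          = w i * (mR * ((H + (t : ℂ) • V i).groundEnergy - H.groundEnergy)) := by ring
        _ ≤ w i * (t ^ 2 * (2 * μ i * trP H (V i * V i) + μ i ^ 2 * trP H (V i * K * V i)) +
            t ^ 3 * (μ i ^ 2 * (|trP H (V i * V i * V i)| + ‖V i‖ * trP H (V i * V i)))) :=
            mul_le_mul_of_nonneg_left (hmode i hi) (hw i hi)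
        _ = _ := by ring
    have hflip : ∑ i ∈ s, w i * ((H + (t : ℂ) • V i).groundEnergy - H.groundEnergy) =
        -∑ i ∈ s, w i * (H.groundEnergy - (H + (t : ℂ) • V i).groundEnergy) := by
      rw [← sum_neg_distrib]
      exact sum_congr rfl fun i _ => by ring
    have hm' := mul_le_mul_of_nonneg_left hGDt hm.le
    rw [hflip] at hsum
    have h4 : 0 ≤ t ^ 2 * (X + t * G) := by
      have e : t ^ 2 * (X + t * G) = mR * (γ / 2 * t ^ 2 * ∑ i ∈ s, w i * Q i) +
          t ^ 2 * S + t ^ 3 * G := by rw [hX]; ring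
      rw [e]
      linarith
    exact (mul_nonneg_iff_of_pos_left (by positivity : (0 : ℝ) < t ^ 2)).1 h4
  have hX0 : 0 ≤ X := nonneg_of_forall_small hδ hG0 key
  -- back to `ω`
  have hfin : ∑ i ∈ s, w i * (γ * Q i / 2 + 2 * μ i * (H.groundStateFunctional (V i * V i)).re +
      μ i ^ 2 * (H.groundStateFunctional (V i * K * V i)).re) = mR⁻¹ * X := by
    simp_rw [re_groundStateFunctional_eq_trP hH]
    rw [hX, mul_add, ← mul_assoc, inv_mul_cancel₀ hm.ne', one_mul, hS, mul_sum, mul_sum,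
      ← sum_add_distrib]
    exact sum_congr rfl fun i _ => by rw [← hmR]; ring
  rw [hfin]
  exact mul_nonneg (inv_nonneg.2 hm.le) hX0

end Literature.MathematicalPhysics.QuantumLattice.XYStabilityTransfer

namespace Literature.MathematicalPhysics.QuantumLattice.XYStabilityTransfer

/-- **Part B. The KLS mode sum from the weighted quadratic form, in one stroke.**
Modes `q ∈ s` with KLS weight `F_q = √((d + C_q)/E_q) {C_q/d}₊`, structure factor `g_q ≥ 0`,
double-commutator density `β_q ≤ ẽ (d + C_q)` on `C_q > 0`, and the weighted quadratic form
`0 ≤ Σ_q F_q (γ + 2ν_q g_q + ν_q² β_q/(4E_q))` for ALL multipliers `ν`. Then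
`Σ_q g_q (C_q/d) ≤ ½ √(ẽ γ) Σ_q F_q` — the input of KLS eq. (7) with `e₁ ↦ ẽ γ`.
(Choice `ν_q = −λ {C_q/d}₊ / F_q`, `λ = 2√γ/√ẽ`.) [cite: KLS1988JSP, eqs. (12)–(14)] -/
theorem kls_modeSum_le_of_quadForm {ι : Type*} (s : Finset ι) {F g C E β : ι → ℝ}
    {d e γ : ℝ} (hd : 0 < d) (he : 0 < e) (hγ : 0 < γ)
    (hE : ∀ q ∈ s, 0 < E q) (hg : ∀ q ∈ s, 0 ≤ g q)
    (hF : ∀ q ∈ s, F q = Real.sqrt ((d + C q) / E q) * max (C q / d) 0)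
    (hβ : ∀ q ∈ s, 0 < C q → β q ≤ e * (d + C q))
    (hquad : ∀ ν : ι → ℝ, 0 ≤ ∑ q ∈ s, F q * (γ + 2 * ν q * g q + ν q ^ 2 * β q / (4 * E q))) :
    ∑ q ∈ s, g q * (C q / d) ≤ 1 / 2 * Real.sqrt (e * γ) * ∑ q ∈ s, F q := by
  set lam : ℝ := 2 * Real.sqrt γ / Real.sqrt e with hlam
  have hse : 0 < Real.sqrt e := Real.sqrt_pos.2 he
  have hsγ : 0 < Real.sqrt γ := Real.sqrt_pos.2 hγ
  have hlam0 : 0 < lam := by positivity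
  have hlam2 : lam ^ 2 * e / 4 = γ := by
    rw [hlam, div_pow, mul_pow, Real.sq_sqrt hγ.le, Real.sq_sqrt he.le]
    field_simp
    ring
  -- the multipliers
  set ν : ι → ℝ := fun q => -(lam * (max (C q / d) 0 / F q)) with hν
  have hF0 : ∀ q ∈ s, 0 ≤ F q := fun q hq => by
    rw [hF q hq]; exact mul_nonneg (Real.sqrt_nonneg _) (le_max_right _ _)
  -- termwise bound
  have hterm : ∀ q ∈ s, F q * (γ + 2 * ν q * g q + ν q ^ 2 * β q / (4 * E q)) ≤
      (γ + lam ^ 2 * e / 4) * F q - 2 * lam * (g q * max (C q / d) 0) := by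
    intro q hq
    rcases le_or_gt (C q) 0 with hC | hC
    · have hmax : max (C q / d) 0 = 0 := max_eq_right (div_nonpos_of_nonpos_of_nonneg hC hd.le)
      have hFq : F q = 0 := by rw [hF q hq, hmax, mul_zero]
      simp [hν, hFq, hmax]
    · have hCd : 0 < C q / d := div_pos hC hd
      have hmax : max (C q / d) 0 = C q / d := max_eq_left hCd.le
      have hdC : 0 < d + C q := by linarith
      have hr : 0 < (d + C q) / E q := div_pos hdC (hE q hq)
      have hFpos : 0 < F q := by rw [hF q hq, hmax]; exact mul_pos (Real.sqrt_pos.2 hr) hCd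
      have hFsq : F q ^ 2 = (d + C q) / E q * (C q / d) ^ 2 := by
        rw [hF q hq, hmax, mul_pow, Real.sq_sqrt hr.le]
      -- `ν = -lam (C/d)/F`
      have hνq : ν q = -(lam * (C q / d) / F q) := by simp only [hν, hmax, mul_div_assoc]
      have hβq := hβ q hq hC
      -- the quadratic term: `ν² β/(4E) ≤ ν² e (d+C)/(4E) = lam² e F² /(4 F²) ...`
      have hν2 : 0 ≤ ν q ^ 2 / (4 * E q) := by have := hE q hq; positivity
      have hA : F q * (ν q ^ 2 * β q / (4 * E q)) ≤ F q * (ν q ^ 2 * (e * (d + C q)) / (4 * E q)) := by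
        refine mul_le_mul_of_nonneg_left ?_ hFpos.le
        rw [mul_div_assoc, mul_div_assoc]
        have : ν q ^ 2 * β q / (4 * E q) = ν q ^ 2 / (4 * E q) * β q := by ring
        have this' : ν q ^ 2 * (e * (d + C q)) / (4 * E q) = ν q ^ 2 / (4 * E q) * (e * (d + C q)) := by
          ring
        rw [mul_div_assoc] at this this'
        rw [this, this']
        exact mul_le_mul_of_nonneg_left hβq hν2
      have hB : F q * (ν q ^ 2 * (e * (d + C q)) / (4 * E q)) = lam ^ 2 * e / 4 * F q := by
        rw [hνq, neg_sq, div_pow, mul_pow]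
        have hE0 : E q ≠ 0 := (hE q hq).ne'
        have hF0' : F q ≠ 0 := hFpos.ne'
        have hd0 : d ≠ 0 := hd.ne'
        field_simp
        rw [hFsq]
        field_simp
        try ring
      have hlin : F q * (2 * ν q * g q) = -(2 * lam * (g q * (C q / d))) := by
        rw [hνq]
        field_simp
        try ring
      rw [hmax]
      calc F q * (γ + 2 * ν q * g q + ν q ^ 2 * β q / (4 * E q))
          = γ * F q + F q * (2 * ν q * g q) + F q * (ν q ^ 2 * β q / (4 * E q)) := by ring
        _ ≤ γ * F q + F q * (2 * ν q * g q) + F q * (ν q ^ 2 * (e * (d + C q)) / (4 * E q)) := by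
            linarith [hA]
        _ = (γ + lam ^ 2 * e / 4) * F q - 2 * lam * (g q * (C q / d)) := by
            rw [hB, hlin]; ring
  -- sum up
  have hsum : 0 ≤ (γ + lam ^ 2 * e / 4) * ∑ q ∈ s, F q -
      2 * lam * ∑ q ∈ s, g q * max (C q / d) 0 := by
    have h := hquad ν
    have h2 : ∑ q ∈ s, F q * (γ + 2 * ν q * g q + ν q ^ 2 * β q / (4 * E q)) ≤
        ∑ q ∈ s, ((γ + lam ^ 2 * e / 4) * F q - 2 * lam * (g q * max (C q / d) 0)) :=
      sum_le_sum hterm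
    rw [sum_sub_distrib, ← mul_sum, ← mul_sum] at h2
    linarith
  rw [hlam2] at hsum
  -- `Σ g C/d ≤ Σ g {C/d}₊`
  have hpos : ∑ q ∈ s, g q * (C q / d) ≤ ∑ q ∈ s, g q * max (C q / d) 0 :=
    sum_le_sum fun q hq => mul_le_mul_of_nonneg_left (le_max_left _ _) (hg q hq)
  -- `lam · ½√(eγ) = γ`
  have hkey : lam * (1 / 2 * Real.sqrt (e * γ)) = γ := by
    rw [Real.sqrt_mul he.le, hlam]
    have hse' : Real.sqrt e ≠ 0 := hse.ne'
    calc 2 * Real.sqrt γ / Real.sqrt e * (1 / 2 * (Real.sqrt e * Real.sqrt γ))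
        = (Real.sqrt γ * Real.sqrt γ) * (Real.sqrt e / Real.sqrt e) := by ring
      _ = γ := by rw [Real.mul_self_sqrt hγ.le, div_self hse', mul_one]
  have h3 : lam * ∑ q ∈ s, g q * max (C q / d) 0 ≤ γ * ∑ q ∈ s, F q := by linarith
  have h4 : lam * ∑ q ∈ s, g q * (C q / d) ≤ lam * (1 / 2 * Real.sqrt (e * γ) * ∑ q ∈ s, F q) := by
    rw [← mul_assoc, hkey]
    exact (mul_le_mul_of_nonneg_left hpos hlam0.le).trans h3
  exact le_of_mul_le_mul_left h4 hlam0

/-- The monotone step of KLS with the shifted constant: if `0 ≤ s ≤ e` and `R' ≤ 4√(s+η)`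
(`R' = R√γ`), then `s − ½√((s+η)) R' ≤ e − ½ √((e+η)) R'` (tree `kls_monotone_step` at
`s+η ≤ e+η`). [folklore] -/
private theorem kls_monotone_step_shift {s e η R' : ℝ} (hs : 0 ≤ s + η) (hse : s ≤ e)
    (hR : R' ≤ 4 * Real.sqrt (s + η)) :
    s - 1 / 2 * Real.sqrt (s + η) * R' ≤ e - 1 / 2 * Real.sqrt (e + η) * R' := by
  have h := kls_monotone_step hs (by linarith : s + η ≤ e + η) hR
  linarith

end Literature.MathematicalPhysics.QuantumLattice.XYStabilityTransfer

/-! # Part C — the perturbation class, the hypothesis `MeanGDn`, the tracial target, and the KLS transfer -/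

namespace Literature.MathematicalPhysics.QuantumLattice.XYStabilityTransfer

open Complex Literature.Probability.LatticeModels

/-! ## C.0 The perturbation class `AdmissibleW₀ ⊇ AdmissibleW ⊇ AdmissibleWsym` -/

/-- The box `[0,R)²` of the torus (support of the generating term of `W`). [folklore] -/
def box (L : ℕ) [NeZero L] (R : ℕ) : Finset (TorusSite 2 L) :=
  Finset.univ.filter fun x => ∀ i, (x i).val < R

/-- **The perturbation class `AdmissibleW₀ ε R`** (literal class: no reality, no lattice symmetry): for every side `L` a Hermitian rule `w_L` supported in the box `[0,R)²`, of operator norm `≤ ε`, commuting with `S³_tot` (`U(1)`); the perturbation is the sum of its translates `W_L = Σ_v τ_v w_L` (a translation-covariant finite-range interaction in the sense of Bratteli–Robinson, `Φ(X + a) = τ_a Φ(X)`). [cite: BratteliRobinsonII1997, §6.2.1] -/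
structure AdmissibleW₀ (ε : ℝ) (R : ℕ) where
  w : (L : ℕ) → [NeZero L] → Op (TorusSite 2 L) (1 + 1)
  herm : ∀ (L : ℕ) [NeZero L], (w L).IsHermitian
  supp : ∀ (L : ℕ) [NeZero L], IsSupportedOn (w L) (box L R)
  norm_le : ∀ (L : ℕ) [NeZero L], ‖w L‖ ≤ ε
  u1 : ∀ (L : ℕ) [NeZero L], Commute (w L) (totalSpin 1 2)

/-- The subclass with `w_L` REAL in the `S³` basis (time-reversal even). [cite: BratteliRobinsonII1997, §6.2.1] -/
structure AdmissibleW (ε : ℝ) (R : ℕ) extends AdmissibleW₀ ε R where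
  real : ∀ (L : ℕ) [NeZero L], (w L).map (starRingEnd ℂ) = w L

/-- The coordinate swap `(x₁, x₂) ↦ (x₂, x₁)` of the torus `(ℤ/Lℤ)²`. [folklore] -/
def swapSite (L : ℕ) : TorusSite 2 L ≃ TorusSite 2 L :=
  Equiv.arrowCongr (Equiv.swap (0 : Fin 2) 1) (Equiv.refl (ZMod L))

/-- **The class the KLS transfer needs**: additionally the generating term is invariant under
the coordinate swap (so `W_L` is, and the perturbed bond correlations do not depend on the lattice
direction — the per-direction Kubo inequality is not available otherwise). All four consumers
(plaquette, `J₁–J₂`-type, BEC lattice gas, SW-dressed Heisenberg) are `D₄`-symmetric. [cite: BratteliRobinsonII1997, §6.2.1] -/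
structure AdmissibleWsym (ε : ℝ) (R : ℕ) extends AdmissibleW ε R where
  swap : ∀ (L : ℕ) [NeZero L], reindexOp (swapSite L) (w L) = w L

namespace AdmissibleW₀

variable {ε : ℝ} {R : ℕ}

/-- `W_L = Σ_{v ∈ 𝕋_L} τ_v w_L`. [folklore] -/
def W (𝒲 : AdmissibleW₀ ε R) (L : ℕ) [NeZero L] : Op (TorusSite 2 L) (1 + 1) :=
  ∑ v : TorusSite 2 L, reindexOp (Equiv.addRight v) (𝒲.w L)

/-- `H'_L = H_L + W_L`, `H_L = xyTorus 2 L 1` (spin ½ XY model). [folklore] -/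
def H (𝒲 : AdmissibleW₀ ε R) (L : ℕ) [NeZero L] : Op (TorusSite 2 L) (1 + 1) :=
  xyTorus 2 L 1 + 𝒲.W L

/-- `W_L` is Hermitian (a sum of translates of the Hermitian rule `w_L`). [folklore] -/
private theorem W_isHermitian (𝒲 : AdmissibleW₀ ε R) (L : ℕ) [NeZero L] : (𝒲.W L).IsHermitian := by
  unfold W Matrix.IsHermitian
  rw [Matrix.conjTranspose_sum]
  refine Finset.sum_congr rfl fun v _ => ?_
  rw [← reindexOp_conjTranspose_eq, (𝒲.herm L).eq]

/-- `H'_L = H_L + W_L` is Hermitian. [folklore] -/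
private theorem H_isHermitian (𝒲 : AdmissibleW₀ ε R) (L : ℕ) [NeZero L] : (𝒲.H L).IsHermitian :=
  (xyTorus_isHermitian 2 L 1).add (𝒲.W_isHermitian L)

/-- The perturbed TRACIAL ground-state correlation `G'^α_L(x,y) = Re ω'_L(S^α_x S^α_y)` [cite: KLS1988PRL, eq. (3)] -/
def corr (𝒲 : AdmissibleW₀ ε R) (L : ℕ) [NeZero L] (α : Fin 3) (x y : TorusSite 2 L) : ℝ :=
  ((𝒲.H L).groundStateFunctional (siteSpin 1 x α * siteSpin 1 y α)).re

/-- The perturbed structure factor `ĝ'_q = |Λ|⁻¹ Σ_{x,y} cos(p_q·(x−y)) G'¹(x,y)`. [cite: KLS1988PRL, eq. (3)] -/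
def sf (𝒲 : AdmissibleW₀ ε R) (L : ℕ) [NeZero L] (q : TorusSite 2 L) : ℝ :=
  (∑ x : TorusSite 2 L, ∑ y : TorusSite 2 L,
      Real.cos (torusPhase L q (x - y)) * 𝒲.corr L 0 x y) / (L : ℝ) ^ 2

/-- The perturbed bond correlation `e'_α = (2|Λ|)⁻¹ Σ_x Σ_i G'^α(x, x+eᵢ)`. [cite: KLS1988PRL, eq. (3)] -/
def bondCorr (𝒲 : AdmissibleW₀ ε R) (L : ℕ) [NeZero L] (α : Fin 3) : ℝ :=
  (∑ x : TorusSite 2 L, ∑ i : Fin 2, 𝒲.corr L α x (x + Pi.single i 1)) / (2 * (L : ℝ) ^ 2)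

/-- The double-commutator density of the two modes:
`β'_q = |Λ|⁻¹ Re ω'(C_q K' C_q + D_q K' D_q)`, `K' = H' − E₀(H')`. [cite: KLS1988JSP, eq. (13)] -/
def beta (𝒲 : AdmissibleW₀ ε R) (L : ℕ) [NeZero L] (q : TorusSite 2 L) : ℝ :=
  (((𝒲.H L).groundStateFunctional (xyCosMode L 1 q *
        (𝒲.H L - ((𝒲.H L).groundEnergy : ℂ) • 1) * xyCosMode L 1 q)).re +
      ((𝒲.H L).groundStateFunctional (xySinMode L 1 q *
        (𝒲.H L - ((𝒲.H L).groundEnergy : ℂ) • 1) * xySinMode L 1 q)).re) / (L : ℝ) ^ 2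

/-- The Gaussian-domination GAIN `Γ'(h) = E₀(H') − E₀(H' − V_h)`. [cite: KLS1988JSP, eqs. (17)–(18)] -/
def gdGain (𝒲 : AdmissibleW₀ ε R) (L : ℕ) [NeZero L] (h : TorusSite 2 L → ℝ) : ℝ :=
  (𝒲.H L).groundEnergy - (𝒲.H L - xyGradField L 1 h).groundEnergy

/-- The xy order-parameter sum in the TRACIAL ground state:
`Re ω'_L(Σ_{x,y} (S¹_x S¹_y + S²_x S²_y))` [cite: KLS1988PRL, eq. (7)] -/
def lroSum (𝒲 : AdmissibleW₀ ε R) (L : ℕ) [NeZero L] : ℝ :=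
  ((𝒲.H L).groundStateFunctional (∑ x : TorusSite 2 L, ∑ y : TorusSite 2 L,
    (siteSpin 1 x 0 * siteSpin 1 y 0 + siteSpin 1 x 1 * siteSpin 1 y 1))).re

end AdmissibleW₀

/-- Plane waves. [folklore] -/
def cosWave (L : ℕ) [NeZero L] (q : TorusSite 2 L) : TorusSite 2 L → ℝ :=
  fun x => Real.cos (torusPhase L q x)

/-- Plane waves. [folklore] -/
def sinWave (L : ℕ) [NeZero L] (q : TorusSite 2 L) : TorusSite 2 L → ℝ :=
  fun x => Real.sin (torusPhase L q x)

/-- The KLS weight divided by the dispersion: `F₂(p_q)/E_q` — the normalisation under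
which the `t → 0` germ of `MeanGDn` is the `F`-weighted (not `F·E`-weighted) zone average of the
Gaussian-domination ratio. [cite: KLS1988JSP, eq. (14)] -/
def klsWeight (L : ℕ) [NeZero L] (q : TorusSite 2 L) : ℝ :=
  klsIntegrand 2 (latticeMomentum L q) / dispersion (latticeMomentum L q)

/-- The KLS weight `F₂(p_q)/E_q` is nonnegative (value `0` at `q = 0`, where `E_q = 0`). [folklore] -/
private theorem klsWeight_nonneg (L : ℕ) [NeZero L] (q : TorusSite 2 L) : 0 ≤ klsWeight L q := by
  unfold klsWeight
  rcases eq_or_ne q 0 with rfl | hq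
  · have : dispersion (latticeMomentum L (0 : TorusSite 2 L)) = 0 := by
      simp [dispersion, latticeMomentum_apply]
    rw [this, div_zero]
  · exact div_nonneg (klsIntegrand_nonneg 2 _) (dispersion_latticeMomentum_pos hq).le

/-- The gradient source of the cosine plane wave is `2E_q · C_q` (tree `xyGradField_cos`). [folklore] -/
private theorem xyGradField_cosWave (L : ℕ) [NeZero L] (q : TorusSite 2 L) :
    xyGradField L 1 (cosWave L q) =
      ((2 * dispersion (latticeMomentum L q) : ℝ) : ℂ) • xyCosMode L 1 q :=
  xyGradField_cos (L := L) (n := 1) q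

/-- The gradient source of the sine plane wave is `2E_q · D_q` (tree `xyGradField_sin`). [folklore] -/
private theorem xyGradField_sinWave (L : ℕ) [NeZero L] (q : TorusSite 2 L) :
    xyGradField L 1 (sinWave L q) =
      ((2 * dispersion (latticeMomentum L q) : ℝ) : ℂ) • xySinMode L 1 q :=
  xyGradField_sin (L := L) (n := 1) q

/-- The field energies of the two plane waves of momentum `q` add up to `2E_q|Λ|` (tree `xyFieldEnergy_cos_add_sin`). [folklore] -/
private theorem xyFieldEnergy_cosWave_add_sinWave (L : ℕ) [NeZero L] (q : TorusSite 2 L) :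
    xyFieldEnergy L (cosWave L q) + xyFieldEnergy L (sinWave L q) =
      2 * dispersion (latticeMomentum L q) * (L : ℝ) ^ 2 :=
  xyFieldEnergy_cos_add_sin (L := L) q

/-! ## C.1 The hypothesis `MeanGDn κ` and the tracial target `TracialLRO` -/

/-- **MeanGDn(κ)** — for every even side `L ≥ 4` and all SMALL amplitudes `t`,
`Σ_{q≠0} (F₂(p_q)/E_q) [Γ'(t cos_q) + Γ'(t sin_q)] ≤ ½(1+κ) Σ_{q≠0} (F₂(p_q)/E_q) [Q(t cos_q) + Q(t sin_q)]`.
Reflection positivity gives it termwise with `κ = 0` at `W = 0`; only the `t → 0` germ is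
consumed (`quadForm_of_meanGDn`). A DEFINITION (hypothesis), not asserted; the weights are those of
Kennedy–Lieb–Shastry's Gaussian-domination step. [cite: KLS1988JSP, eqs. (14), (18)–(19)] -/
def MeanGDn {ε : ℝ} {R : ℕ} (𝒲 : AdmissibleW₀ ε R) (κ : ℝ) : Prop :=
  ∀ (L : ℕ) [NeZero L], Even L → 4 ≤ L → ∃ δ > 0, ∀ t : ℝ, |t| < δ →
    ∑ q ∈ (univ : Finset (TorusSite 2 L)).erase 0,
        klsWeight L q * (𝒲.gdGain L (t • cosWave L q) + 𝒲.gdGain L (t • sinWave L q)) ≤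
      (1 + κ) / 2 * ∑ q ∈ (univ : Finset (TorusSite 2 L)).erase 0,
        klsWeight L q * (xyFieldEnergy L (t • cosWave L q) + xyFieldEnergy L (t • sinWave L q))

/-- Mode-wise approximate Gaussian domination `Γ'(h) ≤ (1+κ) E(h)/2` for every plane wave (for comparison; it implies `MeanGDn`; at `W = 0`, `κ = 0` it is Gaussian domination as used by Kennedy–Lieb–Shastry). A DEFINITION (hypothesis), not asserted. [cite: KLS1988JSP, eqs. (14), (18)] -/
def AGD {ε : ℝ} {R : ℕ} (𝒲 : AdmissibleW₀ ε R) (κ : ℝ) : Prop :=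
  ∀ (L : ℕ) [NeZero L], Even L → 4 ≤ L → ∀ h : TorusSite 2 L → ℝ,
    (𝒲.H L).groundEnergy ≤
      (𝒲.H L - xyGradField L 1 h + ((((1 + κ) * xyFieldEnergy L h / 2 : ℝ)) : ℂ) • 1).groundEnergy

/-- Under the mode-wise hypothesis `AGD 𝒲 κ` the Gaussian-domination gain of every real field `h` on an even torus `L ≥ 4` is at most `(1+κ)` times the free value `E(h)/2`. [cite: KLS1988JSP, eq. (14)] -/
theorem gdGain_le_of_AGD {ε : ℝ} {R : ℕ} {𝒲 : AdmissibleW₀ ε R} {κ : ℝ} (hA : AGD 𝒲 κ)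
    (L : ℕ) [NeZero L] (hL : Even L) (h4 : 4 ≤ L) (h : TorusSite 2 L → ℝ) :
    𝒲.gdGain L h ≤ (1 + κ) * xyFieldEnergy L h / 2 := by
  have hGD := hA L hL h4 h
  rw [groundEnergy_add_smul_one ((𝒲.H_isHermitian L).sub (xyGradField_isHermitian L 1 h))] at hGD
  unfold AdmissibleW₀.gdGain
  linarith

/-- `AGD κ → MeanGDn κ` (termwise, nonnegative weights). [folklore] -/
private theorem meanGDn_of_AGD {ε : ℝ} {R : ℕ} {𝒲 : AdmissibleW₀ ε R} {κ : ℝ} (hA : AGD 𝒲 κ) :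
    MeanGDn 𝒲 κ := by
  intro L _ hL h4
  refine ⟨1, one_pos, fun t _ => ?_⟩
  rw [Finset.mul_sum]
  refine Finset.sum_le_sum fun q _ => ?_
  have hF : 0 ≤ klsWeight L q := klsWeight_nonneg L q
  have hc := gdGain_le_of_AGD hA L hL h4 (t • cosWave L q)
  have hs := gdGain_le_of_AGD hA L hL h4 (t • sinWave L q)
  calc klsWeight L q * (𝒲.gdGain L (t • cosWave L q) + 𝒲.gdGain L (t • sinWave L q))
      ≤ klsWeight L q * ((1 + κ) * xyFieldEnergy L (t • cosWave L q) / 2 +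
          (1 + κ) * xyFieldEnergy L (t • sinWave L q) / 2) :=
        mul_le_mul_of_nonneg_left (add_le_add hc hs) hF
    _ = (1 + κ) / 2 * (klsWeight L q *
        (xyFieldEnergy L (t • cosWave L q) + xyFieldEnergy L (t • sinWave L q))) := by ring

/-- **Tracial LRO**: `c L⁴ ≤ Re ω'_L(Σ_{x,y}(S¹S¹ + S²S²))` for even `L ≥ L₀`, `ω'_L` the
TRACIAL ground state of `H'_L` — the conclusion the tree's KLS chain actually delivers
(`xyGroundCorr` is tracial too); per-ground-vector LRO is not reachable by this bookkeeping. [cite: KLS1988PRL, eq. (7)] -/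
def TracialLRO {ε : ℝ} {R : ℕ} (𝒲 : AdmissibleW₀ ε R) (c : ℝ) (L₀ : ℕ) : Prop :=
  ∀ (L : ℕ) [NeZero L], Even L → L₀ ≤ L → c * (L : ℝ) ^ 4 ≤ 𝒲.lroSum L

/-- **`UniformMeanGDn κ`** — `MeanGDn 𝒲 κ` for ALL rules of range `R` and strength `≤ ε₁`, for some `ε₁ = ε₁(R) > 0`. A DEFINITION (the hypothesis of the conditional theorem `tracialLRO_of_uniformMeanGDn`); for `W ≠ 0` it is NOT known to hold for any `κ < klsKappa₀` (open), at `W = 0` it holds with `κ = 0` by Gaussian domination. [cite: KLS1988JSP, eqs. (14), (18)–(19)] -/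
def UniformMeanGDn (κ : ℝ) : Prop :=
  ∀ R : ℕ, ∃ ε₁ > 0, ∀ 𝒲 : AdmissibleWsym ε₁ R, MeanGDn 𝒲.toAdmissibleW₀ κ

/-- **The KLS transfer at threshold `κ₀`** (a parameterised `Prop`; proved at `κ₀ = klsKappa₀` below, `klsTransferJn`). [cite: KLS1988JSP, eqs. (12)–(14)] -/
def KLSTransferJnAt (κ₀ : ℝ) : Prop :=
  ∀ κ, 0 ≤ κ → κ < κ₀ → ∀ R : ℕ, ∃ ε₀ > 0, ∃ c > 0, ∃ L₀ : ℕ,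
    ∀ 𝒲 : AdmissibleWsym ε₀ R, MeanGDn 𝒲.toAdmissibleW₀ κ → TracialLRO 𝒲.toAdmissibleW₀ c L₀

/-- `κ₀ = 1/(2 I(2)²) − 1` (`≈ 0.195`; in-tree certified `≥ π²/9 − 1 ≈ 0.0966` from
`klsRiemannSum_le` + `klsRiemannSum_tendsto_holds`, `≥ 0.0204` from `klsIntegral_two_le_holds`). [cite: KLS1988PRL, eqs. (7)–(8)] -/
def klsKappa₀ : ℝ := 1 / (2 * klsIntegral 2 ^ 2) - 1

/-- Monotonicity of the classes in the strength. [folklore] -/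
def AdmissibleWsym.relax {ε ε' : ℝ} {R : ℕ} (h : ε ≤ ε') (𝒲 : AdmissibleWsym ε R) :
    AdmissibleWsym ε' R where
  w := 𝒲.w
  herm := 𝒲.herm
  supp := 𝒲.supp
  norm_le := fun L _ => (𝒲.norm_le L).trans h
  u1 := 𝒲.u1
  real := 𝒲.real
  swap := 𝒲.swap

/-- Relaxing the strength bound does not change the Hamiltonian. [folklore] -/
private theorem AdmissibleWsym.relax_H {ε ε' : ℝ} {R : ℕ} (h : ε ≤ ε') (𝒲 : AdmissibleWsym ε R)
    (L : ℕ) [NeZero L] : (𝒲.relax h).toAdmissibleW₀.H L = 𝒲.toAdmissibleW₀.H L := rfl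

/-- `MeanGDn` is insensitive to relaxing the strength bound. [folklore] -/
private theorem AdmissibleWsym.meanGDn_relax_iff {ε ε' : ℝ} {R : ℕ} (h : ε ≤ ε') (𝒲 : AdmissibleWsym ε R)
    (κ : ℝ) : MeanGDn (𝒲.relax h).toAdmissibleW₀ κ ↔ MeanGDn 𝒲.toAdmissibleW₀ κ := Iff.rfl

/-- `TracialLRO` is insensitive to relaxing the strength bound. [folklore] -/
private theorem AdmissibleWsym.tracialLRO_relax_iff {ε ε' : ℝ} {R : ℕ} (h : ε ≤ ε')
    (𝒲 : AdmissibleWsym ε R) (c : ℝ) (L₀ : ℕ) :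
    TracialLRO (𝒲.relax h).toAdmissibleW₀ c L₀ ↔ TracialLRO 𝒲.toAdmissibleW₀ c L₀ := Iff.rfl

/-- The reduction (pure logic, PROVED): KLS transfer below `κ₀` + the uniform crux ⇒ E\*ᵀ. [folklore] -/
private theorem tracialLRO_of_klsTransfer {κ₀ κ : ℝ} (hT : KLSTransferJnAt κ₀) (hκ0 : 0 ≤ κ) (hκ : κ < κ₀)
    (hU : UniformMeanGDn κ) :
    ∀ R : ℕ, ∃ ε₀ > 0, ∃ c > 0, ∃ L₀ : ℕ, ∀ 𝒲 : AdmissibleWsym ε₀ R,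
    TracialLRO 𝒲.toAdmissibleW₀ c L₀ := by
  intro R
  obtain ⟨ε₁, hε₁, hU⟩ := hU R
  obtain ⟨ε₀, hε₀, c, hc, L₀, hT⟩ := hT κ hκ0 hκ R
  refine ⟨min ε₀ ε₁, lt_min hε₀ hε₁, c, hc, L₀, fun 𝒲 => ?_⟩
  have h₀ : min ε₀ ε₁ ≤ ε₀ := min_le_left _ _
  have h₁ : min ε₀ ε₁ ≤ ε₁ := min_le_right _ _
  have hMG : MeanGDn (𝒲.relax h₀).toAdmissibleW₀ κ := by
    rw [AdmissibleWsym.meanGDn_relax_iff, ← AdmissibleWsym.meanGDn_relax_iff h₁]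
    exact hU _
  have := hT (𝒲.relax h₀) hMG
  rwa [AdmissibleWsym.tracialLRO_relax_iff] at this

/-- **The route's deciding implication**: the ONE open crux `UniformMeanGDn κ` (`κ < κ₀`) and the
KLS transfer `KLSTransferJnAt klsKappa₀` (`klsTransferJn` below: proved from the named lattice
facts F1–F5 and Parts A, B) give E\*ᵀ. [folklore] -/
private theorem tracialLRO_of_klsTransferAt {κ : ℝ} (hκ0 : 0 ≤ κ) (hκ : κ < klsKappa₀) (hU : UniformMeanGDn κ)
    (hT : KLSTransferJnAt klsKappa₀) :
    ∀ R : ℕ, ∃ ε₀ > 0, ∃ c > 0, ∃ L₀ : ℕ, ∀ 𝒲 : AdmissibleWsym ε₀ R,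
    TracialLRO 𝒲.toAdmissibleW₀ c L₀ :=
  tracialLRO_of_klsTransfer hT hκ0 hκ hU

/-! ## C.1b State-generic double commutator (the tree's KLS88 eq. (13)/(4) for ANY state)

The tree proves `re_groundStateFunctional_lie_lie(_modes)` for the tracial ground state of `H_XY`
itself; the proofs use only the operator identity `lie_lie_xyTorus` and linearity of the state, so
they go through verbatim for the tracial ground-state functional of ANY matrix `A` (here: of the
perturbed Hamiltonian). This discharges fact F3a below. -/

section StateGenericDC

variable {d : ℕ}

/-- State-generic two-point function `G_A^α(x,y) = Re ω_A(S^α_x S^α_y)`. [cite: KLS1988PRL, eq. (3)] -/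
def corrSt (L : ℕ) [NeZero L] (n : ℕ) (A : Op (TorusSite d L) (n + 1)) (α : Fin 3)
    (x y : TorusSite d L) : ℝ :=
  (A.groundStateFunctional (siteSpin n x α * siteSpin n y α)).re

/-- `G_A^α(x,y) = G_A^α(y,x)` (the state is Hermitian on Hermitian products). [folklore] -/
private theorem corrSt_symm (L : ℕ) [NeZero L] (n : ℕ) (A : Op (TorusSite d L) (n + 1)) (α : Fin 3)
    (x y : TorusSite d L) : corrSt L n A α x y = corrSt L n A α y x := by
  unfold corrSt
  have h : siteSpin n y α * siteSpin n x α =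
      (siteSpin n x α * siteSpin n y α : Op (TorusSite d L) (n + 1))ᴴ := by
    rw [conjTranspose_mul, (siteSpin_isHermitian n x α).eq, (siteSpin_isHermitian n y α).eq]
  rw [h, groundStateFunctional_conjTranspose_re]

/-- `Re ω_A` of the symmetrised bond equals the two-point function. [folklore] -/
private theorem re_groundStateFunctional_spinBond_state (L : ℕ) [NeZero L] (n : ℕ)
    (A : Op (TorusSite d L) (n + 1)) (α : Fin 3) (x y : TorusSite d L) :
    (A.groundStateFunctional (spinBond n α x y)).re = corrSt L n A α x y := by
  rw [spinBond, LinearMap.map_smul, map_add, smul_eq_mul,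
    show (1 / 2 : ℂ) = ((1 / 2 : ℝ) : ℂ) by push_cast; ring, Complex.re_ofReal_mul, Complex.add_re]
  change 1 / 2 * (corrSt L n A α x y + corrSt L n A α y x) = _
  rw [corrSt_symm L n A α y x]
  ring

/-- KLS88 eq. (13), state-generic: `Re ω_A([A_a,[H_XY,A_a]]) = Σ_{⟨xy⟩} ((a_x²+a_y²)G_A²(x,y) −
2a_xa_yG_A³(x,y))` (tree: `re_groundStateFunctional_lie_lie`, same proof). [cite: KLS1988JSP, eq. (13)] -/
theorem re_groundStateFunctional_lie_lie_state (L : ℕ) [NeZero L] (n : ℕ)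
    (A : Op (TorusSite d L) (n + 1)) (a : TorusSite d L → ℝ) :
    (A.groundStateFunctional
      ⁅(∑ u : TorusSite d L, (a u : ℂ) • (siteSpin n u 0 : Op (TorusSite d L) (n + 1))),
        ⁅xyTorus d L n,
          ∑ u : TorusSite d L, (a u : ℂ) • (siteSpin n u 0 : Op (TorusSite d L) (n + 1))⁆⁆).re =
      ∑ e ∈ (torusGraph d L).edgeFinset,
        Sym2.lift ⟨fun x y => (a x ^ 2 + a y ^ 2) * corrSt L n A 1 x y -
          2 * a x * a y * corrSt L n A 2 x y, fun x y => by
            dsimp only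
            rw [corrSt_symm L n A 1 x y, corrSt_symm L n A 2 x y]; ring⟩ e := by
  rw [lie_lie_xyTorus, map_sum, Complex.re_sum]
  refine sum_congr rfl fun e _ => ?_
  refine Sym2.ind (fun x y => ?_) e
  simp only [Sym2.lift_mk, map_sub, LinearMap.map_smul, smul_eq_mul, Complex.sub_re]
  rw [show ((a x : ℂ) ^ 2 + (a y : ℂ) ^ 2) = ((a x ^ 2 + a y ^ 2 : ℝ) : ℂ) by push_cast; ring,
    show (2 * (a x : ℂ) * (a y : ℂ)) = ((2 * a x * a y : ℝ) : ℂ) by push_cast; ring,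
    Complex.re_ofReal_mul, Complex.re_ofReal_mul, re_groundStateFunctional_spinBond_state,
    re_groundStateFunctional_spinBond_state]

/-- KLS88 eq. (4) numerator, state-generic (tree: `re_groundStateFunctional_lie_lie_modes`, same
proof): `Re ω_A([C_q,[H,C_q]]) + Re ω_A([D_q,[H,D_q]]) = 2 Σᵢ Σ_z (G_A²(z,z+eᵢ) − cos qᵢ G_A³(z,z+eᵢ))`.
 [cite: KLS1988JSP, eq. (13)] -/
theorem re_groundStateFunctional_lie_lie_modes_state (L : ℕ) [NeZero L] (n : ℕ) (hL : 3 ≤ L)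
    (A : Op (TorusSite d L) (n + 1)) (q : TorusSite d L) :
    (A.groundStateFunctional ⁅xyCosMode L n q, ⁅xyTorus d L n, xyCosMode L n q⁆⁆).re +
      (A.groundStateFunctional ⁅xySinMode L n q, ⁅xyTorus d L n, xySinMode L n q⁆⁆).re =
      2 * ∑ i : Fin d, ∑ z : TorusSite d L,
        (corrSt L n A 1 z (z + Pi.single i 1) -
          Real.cos (latticeMomentum L q i) * corrSt L n A 2 z (z + Pi.single i 1)) := by
  rw [xyCosMode, xySinMode, re_groundStateFunctional_lie_lie_state,
    re_groundStateFunctional_lie_lie_state, ← sum_add_distrib]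
  have hcomb : ∀ e ∈ (torusGraph d L).edgeFinset,
      Sym2.lift ⟨fun x y => (Real.cos (torusPhase L q x) ^ 2 + Real.cos (torusPhase L q y) ^ 2) *
          corrSt L n A 1 x y - 2 * Real.cos (torusPhase L q x) * Real.cos (torusPhase L q y) *
          corrSt L n A 2 x y, fun x y => by
            dsimp only
            rw [corrSt_symm L n A 1 x y, corrSt_symm L n A 2 x y]; ring⟩ e +
        Sym2.lift ⟨fun x y => (Real.sin (torusPhase L q x) ^ 2 + Real.sin (torusPhase L q y) ^ 2) *
          corrSt L n A 1 x y - 2 * Real.sin (torusPhase L q x) * Real.sin (torusPhase L q y) *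
          corrSt L n A 2 x y, fun x y => by
            dsimp only
            rw [corrSt_symm L n A 1 x y, corrSt_symm L n A 2 x y]; ring⟩ e =
      2 * Sym2.lift ⟨fun x y => corrSt L n A 1 x y -
          Real.cos (torusPhase L q (x - y)) * corrSt L n A 2 x y, fun x y => by
            dsimp only
            rw [corrSt_symm L n A 1 x y, corrSt_symm L n A 2 x y, cos_torusPhase_sub,
              cos_torusPhase_sub]; ring⟩ e := by
    intro e _
    refine Sym2.ind (fun x y => ?_) e
    simp only [Sym2.lift_mk]
    rw [cos_torusPhase_sub]
    linear_combination (corrSt L n A 1 x y) * Real.cos_sq_add_sin_sq (torusPhase L q x) +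
      (corrSt L n A 1 x y) * Real.cos_sq_add_sin_sq (torusPhase L q y)
  rw [sum_congr rfl hcomb, ← mul_sum]
  congr 1
  have hpairs := sum_pairs_eq_sum_edgeFinset (d := d) L (by omega)
    (Sym2.lift ⟨fun x y => corrSt L n A 1 x y -
      Real.cos (torusPhase L q (x - y)) * corrSt L n A 2 x y, fun x y => by
        dsimp only
        rw [corrSt_symm L n A 1 x y, corrSt_symm L n A 2 x y, cos_torusPhase_sub,
          cos_torusPhase_sub]; ring⟩)
  rw [if_neg (by omega), one_mul] at hpairs
  rw [← hpairs, sum_comm]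
  refine sum_congr rfl fun i _ => sum_congr rfl fun z _ => ?_
  simp only [Sym2.lift_mk]
  rw [sub_add_cancel_left, cos_torusPhase_neg_single]

end StateGenericDC

/-! ## C.1c Symmetry toolkit (translations, axis swap, quarter turn) -/

section Toolkit

variable {Λ : Type*} [Fintype Λ] [DecidableEq Λ] {q : ℕ}

/-- `reindexOp e` is the reindexing `σ ↦ σ ∘ e` of both tensor indices. [folklore] -/
private theorem reindexOp_eq_submatrix (e : Λ ≃ Λ) (A : Op Λ q) :
    reindexOp e A = A.submatrix (fun σ => σ ∘ e) (fun σ => σ ∘ e) :=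
  Matrix.ext fun _ _ => rfl

/-- `reindexOp` is functorial in the relabelling. [folklore] -/
private theorem reindexOp_trans (e f : Λ ≃ Λ) (A : Op Λ q) :
    reindexOp (e.trans f) A = reindexOp f (reindexOp e A) :=
  Matrix.ext fun _ _ => rfl

/-- `S^α_tot` is invariant under site relabellings (tree: `LiebMattis.reindexOp_totalSpin`). [folklore] -/
private theorem reindexOp_totalSpin' (e : Λ ≃ Λ) (n : ℕ) (α : Fin 3) :
    reindexOp e (totalSpin (Λ := Λ) n α) = totalSpin n α := by
  simp only [totalSpin, map_sum, reindexOp_siteSpin]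
  exact Equiv.sum_comp e (fun y => (siteSpin n y α : Op Λ (n + 1)))

/-- An operator commuting with `diagonal t` commutes with `diagonal u` whenever `u` is a function
of `t`. [folklore] -/
private theorem commute_diagonal_of_commute_diagonal {ι : Type*} [Fintype ι] [DecidableEq ι]
    {A : Matrix ι ι ℂ} {t u : ι → ℂ} (h : Commute A (diagonal t))
    (htu : ∀ i j, t i = t j → u i = u j) : Commute A (diagonal u) := by
  have key : ∀ i j, A i j * t j = t i * A i j := fun i j => by
    have := congrFun (congrFun h.eq i) j
    rwa [mul_diagonal, diagonal_mul] at this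
  change A * diagonal u = diagonal u * A
  ext i j
  rw [mul_diagonal, diagonal_mul]
  by_cases hA : A i j = 0
  · rw [hA, zero_mul, mul_zero]
  · have ht : t i = t j := by
      have h1 := key i j
      rw [mul_comm] at h1
      exact (mul_right_cancel₀ hA h1).symm
    rw [htu i j ht, mul_comm]

omit [DecidableEq Λ] in
/-- The quarter turn about the 3-axis is diagonal: `⨂_x diag((-i)^k) = diag_σ (-i)^{Σ_x σ_x}`. [folklore] -/
private theorem quarterTurn_eq_diagonal (n : ℕ) :
    (productOp (fun _ : Λ => diagonal fun k : Fin (n + 1) => (-Complex.I) ^ (k : ℕ)) :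
        Op Λ (n + 1)) = diagonal fun σ => (-Complex.I) ^ (∑ x, (σ x : ℕ)) := by
  ext σ τ
  rw [productOp_apply, diagonal_apply]
  by_cases h : σ = τ
  · subst h
    rw [if_pos rfl, ← Finset.prod_pow_eq_pow_sum]
    exact Finset.prod_congr rfl fun x _ => diagonal_apply_eq _ _
  · rw [if_neg h]
    obtain ⟨x, hx⟩ := Function.ne_iff.mp h
    exact Finset.prod_eq_zero (Finset.mem_univ x) (diagonal_apply_ne _ hx)

/-- **`U(1)` ⇒ quarter-turn invariance**: an operator commuting with `S³_tot` commutes with the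
quarter turn (both are diagonal in the `Sᶻ` basis, the latter a function of the former). [folklore] -/
private theorem commute_quarterTurn_of_commute_totalSpin_two (n : ℕ) {A : Op Λ (n + 1)}
    (h : Commute A (totalSpin n 2)) :
    Commute A (productOp (fun _ : Λ => diagonal fun k : Fin (n + 1) => (-Complex.I) ^ (k : ℕ))) := by
  rw [quarterTurn_eq_diagonal]
  rw [LiebMattis.totalSpin_two_eq_diagonal] at h
  refine commute_diagonal_of_commute_diagonal h fun σ τ hστ => ?_
  have h1 : (∑ x, ((σ x : ℕ) : ℂ)) = ∑ x, ((τ x : ℕ) : ℂ) := by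
    simp only [Finset.sum_sub_distrib] at hστ
    exact sub_right_injective hστ
  have h2 : (∑ x, (σ x : ℕ)) = ∑ x, (τ x : ℕ) := by exact_mod_cast h1
  simp only [h2]

variable {d : ℕ}

/-- `Σ_x cos(p_q · x) = 0` for `q ≠ 0` (orthogonality of characters, in the site variable). [folklore] -/
private theorem sum_cos_torusPhase_site (L : ℕ) [NeZero L] {k : TorusSite d L} (hk : k ≠ 0) :
    ∑ x : TorusSite d L, Real.cos (torusPhase L k x) = 0 := by
  have key : ∀ x : TorusSite d L, Real.cos (torusPhase L k x) =
      (∏ j, (ZMod.stdAddChar (x j * k j) : ℂ)).re := fun x => by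
    rw [show (∏ j, (ZMod.stdAddChar (x j * k j) : ℂ)) = ∏ j, (ZMod.stdAddChar (k j * x j) : ℂ)
      from Finset.prod_congr rfl fun j _ => by rw [mul_comm], torusChar_re]
  simp_rw [key]
  rw [← Complex.re_sum, sum_torusChar, if_neg hk, Complex.zero_re]

/-- `Σ_x sin(p_q · x) = 0` for `q ≠ 0`. [folklore] -/
private theorem sum_sin_torusPhase_site (L : ℕ) [NeZero L] {k : TorusSite d L} (hk : k ≠ 0) :
    ∑ x : TorusSite d L, Real.sin (torusPhase L k x) = 0 := by
  have key : ∀ x : TorusSite d L, Real.sin (torusPhase L k x) =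
      (∏ j, (ZMod.stdAddChar (x j * k j) : ℂ)).im := fun x => by
    rw [show (∏ j, (ZMod.stdAddChar (x j * k j) : ℂ)) = ∏ j, (ZMod.stdAddChar (k j * x j) : ℂ)
      from Finset.prod_congr rfl fun j _ => by rw [mul_comm], torusChar_eq_exp,
      Complex.exp_ofReal_mul_I_im]
  simp_rw [key]
  rw [← Complex.im_sum, sum_torusChar, if_neg hk, Complex.zero_im]

/-- `|Λ| = L²`. [folklore] -/
private theorem card_torusSite_two (L : ℕ) [NeZero L] :
    (Fintype.card (TorusSite 2 L) : ℝ) = (L : ℝ) ^ 2 := by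
  rw [Fintype.card_pi, prod_const, ZMod.card, card_univ, Fintype.card_fin]; push_cast; ring

end Toolkit

namespace AdmissibleW₀

variable {ε : ℝ} {R : ℕ}

/-- `W_L` is `U(1)`-invariant. [folklore] -/
private theorem commute_W_totalSpin (𝒲 : AdmissibleW₀ ε R) (L : ℕ) [NeZero L] :
    Commute (𝒲.W L) (totalSpin 1 2) := by
  unfold W
  refine Commute.sum_left _ _ _ fun v _ => ?_
  have h := (𝒲.u1 L).map (reindexOp (Equiv.addRight v))
  rwa [reindexOp_totalSpin'] at h

/-- `W_L` is translation invariant. [folklore] -/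
private theorem reindexOp_addRight_W (𝒲 : AdmissibleW₀ ε R) (L : ℕ) [NeZero L] (u : TorusSite 2 L) :
    reindexOp (Equiv.addRight u) (𝒲.W L) = 𝒲.W L := by
  unfold W
  rw [map_sum]
  have h : ∀ v : TorusSite 2 L,
      reindexOp (Equiv.addRight u) (reindexOp (Equiv.addRight v) (𝒲.w L)) =
        reindexOp (Equiv.addRight (v + u)) (𝒲.w L) := fun v => by
    rw [← reindexOp_trans, show (Equiv.addRight v).trans (Equiv.addRight u) =
      Equiv.addRight (v + u) from Equiv.ext fun x => add_assoc x v u]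
  simp_rw [h]
  exact Equiv.sum_comp (Equiv.addRight u) (fun v => reindexOp (Equiv.addRight v) (𝒲.w L))

/-- `H'_L` is translation invariant. [folklore] -/
private theorem H_submatrix_addRight (𝒲 : AdmissibleW₀ ε R) (L : ℕ) [NeZero L] (u : TorusSite 2 L) :
    (𝒲.H L).submatrix (fun σ => σ ∘ Equiv.addRight u) (fun σ => σ ∘ Equiv.addRight u) = 𝒲.H L := by
  have h1 : (xyTorus 2 L 1).submatrix (fun σ => σ ∘ Equiv.addRight u)
      (fun σ => σ ∘ Equiv.addRight u) = xyTorus 2 L 1 :=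
    xxzTorus_submatrix_comp_addRight' L 1 (-1) 0 u
  have h2 : (𝒲.W L).submatrix (fun σ => σ ∘ Equiv.addRight u)
      (fun σ => σ ∘ Equiv.addRight u) = 𝒲.W L := by
    rw [← reindexOp_eq_submatrix, reindexOp_addRight_W]
  change (xyTorus 2 L 1 + 𝒲.W L).submatrix _ _ = xyTorus 2 L 1 + 𝒲.W L
  rw [submatrix_add, Pi.add_apply, Pi.add_apply, h1, h2]

/-- Translation invariance of the perturbed tracial ground state. [folklore] -/
private theorem gsf_reindexOp_addRight (𝒲 : AdmissibleW₀ ε R) (L : ℕ) [NeZero L] (u : TorusSite 2 L)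
    (O : Op (TorusSite 2 L) (1 + 1)) :
    (𝒲.H L).groundStateFunctional (reindexOp (Equiv.addRight u) O) =
      (𝒲.H L).groundStateFunctional O := by
  rw [reindexOp_eq_submatrix]
  exact groundStateFunctional_submatrix_comp (𝒲.H_isHermitian L) (Equiv.addRight u)
    (𝒲.H_submatrix_addRight L u) O

/-- One-point functions of the perturbed tracial state do not depend on the site (translation invariance). [folklore] -/
private theorem gsf_siteSpin_eq (𝒲 : AdmissibleW₀ ε R) (L : ℕ) [NeZero L] (x : TorusSite 2 L)
    (α : Fin 3) :
    (𝒲.H L).groundStateFunctional (siteSpin 1 x α) =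
      (𝒲.H L).groundStateFunctional (siteSpin 1 0 α) := by
  have h := 𝒲.gsf_reindexOp_addRight L x (siteSpin 1 0 α)
  simp only [reindexOp_siteSpin, Equiv.coe_addRight, zero_add] at h
  exact h

/-- `|Re ω_A(W_L)| ≤ |Λ| ε` for every translation-invariant tracial ground state `ω_A`. [folklore] -/
private theorem abs_re_gsf_W_le (L : ℕ) [NeZero L] {A : Op (TorusSite 2 L) (1 + 1)} (hA : A.IsHermitian)
    (hinv : ∀ u : TorusSite 2 L,
      A.submatrix (fun σ => σ ∘ Equiv.addRight u) (fun σ => σ ∘ Equiv.addRight u) = A)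
    (𝒲 : AdmissibleW₀ ε R) : |(A.groundStateFunctional (𝒲.W L)).re| ≤ (L : ℝ) ^ 2 * ε := by
  have hterm : ∀ v : TorusSite 2 L,
      (A.groundStateFunctional (reindexOp (Equiv.addRight v) (𝒲.w L))).re =
        (A.groundStateFunctional (𝒲.w L)).re := fun v => by
    rw [reindexOp_eq_submatrix, groundStateFunctional_submatrix_comp hA (Equiv.addRight v) (hinv v)]
  unfold W
  rw [map_sum, Complex.re_sum]
  simp_rw [hterm]
  rw [Finset.sum_const, Finset.card_univ, nsmul_eq_mul, card_torusSite_two, abs_mul,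
    abs_of_nonneg (by positivity : (0 : ℝ) ≤ (L : ℝ) ^ 2)]
  exact mul_le_mul_of_nonneg_left
    ((abs_re_groundStateFunctional_le_norm hA _).trans (𝒲.norm_le L)) (by positivity)

/-- The quarter turn commutes with `H'_L`. [folklore] -/
private theorem quarterTurn_mul_H (𝒲 : AdmissibleW₀ ε R) (L : ℕ) [NeZero L] :
    productOp (fun _ : TorusSite 2 L => diagonal fun k : Fin (1 + 1) => (-Complex.I) ^ (k : ℕ)) *
        𝒲.H L =
      𝒲.H L *
        productOp (fun _ : TorusSite 2 L => diagonal fun k : Fin (1 + 1) => (-Complex.I) ^ (k : ℕ)) := by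
  set U : Op (TorusSite 2 L) (1 + 1) :=
    productOp (fun _ : TorusSite 2 L => diagonal fun k : Fin (1 + 1) => (-Complex.I) ^ (k : ℕ))
    with hU
  have hUU : Uᴴ * U = 1 := productOp_conjTranspose_mul fun _ => spinPhase_conjTranspose_mul 1
  have hxy : U * xyTorus 2 L 1 = xyTorus 2 L 1 * U := by
    have h := quarterTurn_conj_xxzHamiltonian 1 (torusGraph 2 L) (-1) 0
    have h2 := congrArg (· * U) h
    simp only at h2
    rw [mul_assoc, hUU, mul_one] at h2
    exact h2
  have hW : U * 𝒲.W L = 𝒲.W L * U :=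
    (commute_quarterTurn_of_commute_totalSpin_two 1 (𝒲.commute_W_totalSpin L)).eq.symm
  change U * (xyTorus 2 L 1 + 𝒲.W L) = (xyTorus 2 L 1 + 𝒲.W L) * U
  rw [mul_add, add_mul, hxy, hW]

/-- **F3c (S′)** `G'²(x,y) = G'¹(x,y)`. [cite: KLS1988PRL, after eq. (3)] -/
theorem corr_one_eq_corr_zero' (𝒲 : AdmissibleW₀ ε R) (L : ℕ) [NeZero L] (x y : TorusSite 2 L) :
    𝒲.corr L 1 x y = 𝒲.corr L 0 x y := by
  unfold corr
  set U : Op (TorusSite 2 L) (1 + 1) :=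
    productOp (fun _ : TorusSite 2 L => diagonal fun k : Fin (1 + 1) => (-Complex.I) ^ (k : ℕ))
    with hU
  have hUU : Uᴴ * U = 1 := productOp_conjTranspose_mul fun _ => spinPhase_conjTranspose_mul 1
  have hcomm : U * 𝒲.H L = 𝒲.H L * U := 𝒲.quarterTurn_mul_H L
  have hinv := groundStateFunctional_conj_of_commute (𝒲.H_isHermitian L) hcomm hUU
    (siteSpin 1 x 1 * siteSpin 1 y 1)
  rw [productOp_conj_mul (fun _ => spinPhase_conjTranspose_mul 1),
    quarterTurn_conj_siteSpin_one, quarterTurn_conj_siteSpin_one] at hinv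
  rw [hinv]

/-- **F1 (centring)**. [folklore] -/
private theorem oneMode_centred' (𝒲 : AdmissibleW₀ ε R) (L : ℕ) [NeZero L] {q : TorusSite 2 L}
    (hq : q ≠ 0) :
    ((𝒲.H L).groundStateFunctional (xyCosMode L 1 q)).re = 0 ∧
      ((𝒲.H L).groundStateFunctional (xySinMode L 1 q)).re = 0 := by
  have hm : ∀ x : TorusSite 2 L, (𝒲.H L).groundStateFunctional (siteSpin 1 x 0) =
      (𝒲.H L).groundStateFunctional (siteSpin 1 0 0) := fun x => 𝒲.gsf_siteSpin_eq L x 0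
  constructor
  · rw [xyCosMode, map_sum]
    simp only [LinearMap.map_smul, smul_eq_mul, hm]
    rw [← Finset.sum_mul, ← Complex.ofReal_sum, sum_cos_torusPhase_site L hq, Complex.ofReal_zero,
      zero_mul, Complex.zero_re]
  · rw [xySinMode, map_sum]
    simp only [LinearMap.map_smul, smul_eq_mul, hm]
    rw [← Finset.sum_mul, ← Complex.ofReal_sum, sum_sin_torusPhase_site L hq, Complex.ofReal_zero,
      zero_mul, Complex.zero_re]

/-- **F5 (D′)** `e'₁ ≥ 1/8 − ε/2` for `L ≥ 3`. [cite: KLS1988PRL, after eq. (8)] -/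
theorem bondCorr_lower' (𝒲 : AdmissibleW₀ ε R) (L : ℕ) [NeZero L] (hL : 3 ≤ L) :
    1 / 8 - ε / 2 ≤ 𝒲.bondCorr L 0 := by
  have hL2 : 2 ≤ L := by omega
  have hL3 : L ≠ 2 := by omega
  have hH := 𝒲.H_isHermitian L
  have h0 := xyTorus_isHermitian 2 L 1
  set E := (torusGraph 2 L).edgeFinset with hE
  set g : Sym2 (TorusSite 2 L) → ℝ :=
    Sym2.lift ⟨fun x y => 𝒲.corr L 0 x y, fun x y => corrSt_symm L 1 (𝒲.H L) 0 x y⟩ with hg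
  -- (1) `Re ω'(H_L) = -2 Σ_E G'¹`
  have h1 : ((𝒲.H L).groundStateFunctional (xyTorus 2 L 1)).re = -2 * ∑ e ∈ E, g e := by
    rw [xyTorus_eq_bondSum L 1, map_sum, Complex.re_sum, Finset.mul_sum]
    refine Finset.sum_congr rfl fun e _ => ?_
    induction e using Sym2.ind with
    | h x y =>
      simp only [Sym2.lift_mk, map_add, LinearMap.map_smul, smul_eq_mul, Complex.add_re,
        Complex.re_ofReal_mul, re_groundStateFunctional_spinBond_state]
      have hS : corrSt L 1 (𝒲.H L) 1 x y = corrSt L 1 (𝒲.H L) 0 x y :=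
        𝒲.corr_one_eq_corr_zero' L x y
      rw [hS]
      change _ = -2 * corrSt L 1 (𝒲.H L) 0 x y
      ring
  -- (2) pairs versus edges (`L ≥ 3`)
  have h2 : ∑ x : TorusSite 2 L, ∑ i : Fin 2, 𝒲.corr L 0 x (x + Pi.single i 1) = ∑ e ∈ E, g e := by
    have h := sum_pairs_eq_sum_edgeFinset L hL2 g
    rw [if_neg hL3, one_mul] at h
    exact h
  have hb : 𝒲.bondCorr L 0 = (∑ e ∈ E, g e) / (2 * (L : ℝ) ^ 2) := by
    rw [bondCorr, h2]
  -- (3) `E₀(H') = Re ω'(H_L) + Re ω'(W_L)` and `|Re ω'(W_L)| ≤ |Λ| ε`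
  have h3 : (𝒲.H L).groundEnergy = ((𝒲.H L).groundStateFunctional (xyTorus 2 L 1)).re +
      ((𝒲.H L).groundStateFunctional (𝒲.W L)).re := by
    rw [← Complex.add_re, ← map_add]
    change _ = ((𝒲.H L).groundStateFunctional (𝒲.H L)).re
    rw [Matrix.groundStateFunctional_hamiltonian hH, Complex.ofReal_re]
  have hW' := abs_re_gsf_W_le L hH (𝒲.H_submatrix_addRight L) 𝒲
  -- (4) variational: `E₀(H') ≤ E₀(H_L) + |Λ| ε`
  have h4 : (𝒲.H L).groundEnergy ≤ (xyTorus 2 L 1).groundEnergy + (L : ℝ) ^ 2 * ε := by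
    have hv := Matrix.groundEnergy_le_groundStateFunctional_re h0 hH
    have hsplit : ((xyTorus 2 L 1).groundStateFunctional (𝒲.H L)).re =
        (xyTorus 2 L 1).groundEnergy + ((xyTorus 2 L 1).groundStateFunctional (𝒲.W L)).re := by
      change ((xyTorus 2 L 1).groundStateFunctional (xyTorus 2 L 1 + 𝒲.W L)).re = _
      rw [map_add, Complex.add_re, Matrix.groundStateFunctional_hamiltonian h0, Complex.ofReal_re]
    have hW0 := abs_re_gsf_W_le L h0 (fun u => xxzTorus_submatrix_comp_addRight' L 1 (-1) 0 u) 𝒲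
    rw [hsplit] at hv
    linarith [(abs_le.1 hW0).2]
  -- (5) `E₀(H_L) ≤ -|Λ|/2` (tree (D))
  have h5 : (xyTorus 2 L 1).groundEnergy ≤ -((L : ℝ) ^ 2 / 2) := by
    set g₀ : Sym2 (TorusSite 2 L) → ℝ :=
      Sym2.lift ⟨fun x y => xyGroundCorr 0 L 1 x y, fun x y => xyGroundCorr_symm 0 L 1 x y⟩ with hg₀
    have he : (xyTorus 2 L 1).groundEnergy = -2 * ∑ e ∈ E, g₀ e := by
      rw [← re_groundStateFunctional_xyTorus, Matrix.groundStateFunctional_hamiltonian h0,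
        Complex.ofReal_re]
    have hD := kls_xy_bondCorr_lower_holds 2 (by norm_num) L 1 hL2
    have hp := sum_pairs_eq_sum_edgeFinset L hL2 g₀
    rw [if_neg hL3, one_mul] at hp
    have hp' : ∑ x : TorusSite 2 L, ∑ i : Fin 2, xyGroundCorr 0 L 1 x (x + Pi.single i 1) =
        ∑ e ∈ E, g₀ e := hp
    rw [xyBondCorr_of_neZero, hp'] at hD
    have hLpos : (0 : ℝ) < 2 * (L : ℝ) ^ 2 := by
      have : (0 : ℝ) < L := by exact_mod_cast Nat.pos_of_ne_zero (NeZero.ne L)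
      positivity
    norm_num at hD
    rw [le_div_iff₀ hLpos] at hD
    rw [he]
    linarith
  -- (6) combine
  have hLpos : (0 : ℝ) < 2 * (L : ℝ) ^ 2 := by
    have : (0 : ℝ) < L := by exact_mod_cast Nat.pos_of_ne_zero (NeZero.ne L)
    positivity
  rw [hb, le_div_iff₀ hLpos]
  linarith [(abs_le.1 hW').1]

end AdmissibleW₀

namespace AdmissibleWsym

variable {ε : ℝ} {R : ℕ}

/-- The axis swap acts by precomposition with `Equiv.swap 0 1`. [folklore] -/
private theorem swapSite_apply (L : ℕ) (f : TorusSite 2 L) : swapSite L f = f ∘ Equiv.swap 0 1 := rfl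

/-- `H'_L` is invariant under the axis swap (uses the swap symmetry of the rule). [folklore] -/
private theorem H_submatrix_swap (𝒲 : AdmissibleWsym ε R) (L : ℕ) [NeZero L] :
    (𝒲.toAdmissibleW₀.H L).submatrix (fun σ => σ ∘ swapSite L) (fun σ => σ ∘ swapSite L) =
      𝒲.toAdmissibleW₀.H L := by
  have hπ : Equiv.arrowCongr (Equiv.swap (0 : Fin 2) 1).symm (Equiv.refl (ZMod L)) = swapSite L := by
    rw [Equiv.symm_swap]; rfl
  have h1 : (xyTorus 2 L 1).submatrix (fun σ => σ ∘ swapSite L) (fun σ => σ ∘ swapSite L) =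
      xyTorus 2 L 1 := by
    have h := xyTorus_submatrix_comp_perm L 1 (Equiv.swap (0 : Fin 2) 1)
    rwa [hπ] at h
  have hadd : ∀ v : TorusSite 2 L, (Equiv.addRight v).trans (swapSite L) =
      (swapSite L).trans (Equiv.addRight (swapSite L v)) := fun v => Equiv.ext fun x => rfl
  have h2 : (𝒲.toAdmissibleW₀.W L).submatrix (fun σ => σ ∘ swapSite L) (fun σ => σ ∘ swapSite L) =
      𝒲.toAdmissibleW₀.W L := by
    rw [← reindexOp_eq_submatrix]
    unfold AdmissibleW₀.W
    rw [map_sum]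
    have h : ∀ v : TorusSite 2 L, reindexOp (swapSite L)
        (reindexOp (Equiv.addRight v) (𝒲.w L)) =
          reindexOp (Equiv.addRight (swapSite L v)) (𝒲.w L) := fun v => by
      rw [← reindexOp_trans, hadd, reindexOp_trans, 𝒲.swap L]
    simp_rw [h]
    exact Equiv.sum_comp (swapSite L) (fun v => reindexOp (Equiv.addRight v) (𝒲.w L))
  change (xyTorus 2 L 1 + 𝒲.toAdmissibleW₀.W L).submatrix _ _ = xyTorus 2 L 1 + 𝒲.toAdmissibleW₀.W L
  rw [submatrix_add, Pi.add_apply, Pi.add_apply, h1, h2]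

/-- The perturbed two-point functions are invariant under the axis swap (uses the swap symmetry of the rule). [folklore] -/
private theorem corr_swap (𝒲 : AdmissibleWsym ε R) (L : ℕ) [NeZero L] (α : Fin 3) (x y : TorusSite 2 L) :
    𝒲.toAdmissibleW₀.corr L α (swapSite L x) (swapSite L y) = 𝒲.toAdmissibleW₀.corr L α x y := by
  unfold AdmissibleW₀.corr
  rw [← siteSpin_submatrix_comp 1 (swapSite L) x α, ← siteSpin_submatrix_comp 1 (swapSite L) y α,
    ← Matrix.submatrix_mul _ _ _ _ _ (bijective_comp_equiv (q := 1 + 1) (swapSite L)),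
    groundStateFunctional_submatrix_comp (𝒲.toAdmissibleW₀.H_isHermitian L) (swapSite L)
      (𝒲.H_submatrix_swap L)]

/-- **F3d (SYM′)**. [folklore] -/
private theorem bond_dir_symm' (𝒲 : AdmissibleWsym ε R) (L : ℕ) [NeZero L] (α : Fin 3) :
    ∑ z : TorusSite 2 L, 𝒲.toAdmissibleW₀.corr L α z (z + Pi.single 0 1) =
      ∑ z : TorusSite 2 L, 𝒲.toAdmissibleW₀.corr L α z (z + Pi.single 1 1) := by
  have hs : ∀ z : TorusSite 2 L, swapSite L (z + Pi.single 0 1) = swapSite L z + Pi.single 1 1 := by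
    intro z
    have h := add_single_comp_perm L (Equiv.swap (0 : Fin 2) 1) z 0
    rw [Equiv.symm_swap, Equiv.swap_apply_left] at h
    rw [swapSite_apply, swapSite_apply]
    exact h
  calc ∑ z : TorusSite 2 L, 𝒲.toAdmissibleW₀.corr L α z (z + Pi.single 0 1)
      = ∑ z : TorusSite 2 L, 𝒲.toAdmissibleW₀.corr L α (swapSite L z)
          (swapSite L z + Pi.single 1 1) :=
        Finset.sum_congr rfl fun z _ => by rw [← 𝒲.corr_swap L α z, hs]
    _ = ∑ z : TorusSite 2 L, 𝒲.toAdmissibleW₀.corr L α z (z + Pi.single 1 1) :=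
        (swapSite L).sum_comp (fun z => 𝒲.toAdmissibleW₀.corr L α z (z + Pi.single 1 1))

end AdmissibleWsym

/-! ## C.1d (LIT g10, W-P2) Kubo′ for the perturbed tracial state — discharge of F3e -/

namespace AdmissibleW₀

variable {ε : ℝ} {R : ℕ}

/-- State-generic version of the tree's `re_groundStateFunctional_bondSum`: the tracial ground
state of ANY matrix `A` on a weighted bond sum. [folklore] -/
private theorem re_gsf_bondSum_state {d : ℕ} (L : ℕ) [NeZero L] (n : ℕ) (A : Op (TorusSite d L) (n + 1))
    (a b c : ℝ) :
    (A.groundStateFunctional (∑ e ∈ (torusGraph d L).edgeFinset,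
      Sym2.lift ⟨fun x y => (a : ℂ) • spinBond n 0 x y + (b : ℂ) • spinBond n 1 x y +
        (c : ℂ) • spinBond n 2 x y, fun x y => by simp only [spinBond_comm]⟩ e)).re =
      a * ∑ e ∈ (torusGraph d L).edgeFinset, Sym2.lift
          ⟨fun x y => corrSt L n A 0 x y, fun x y => corrSt_symm L n A 0 x y⟩ e +
      b * ∑ e ∈ (torusGraph d L).edgeFinset, Sym2.lift
          ⟨fun x y => corrSt L n A 1 x y, fun x y => corrSt_symm L n A 1 x y⟩ e +
      c * ∑ e ∈ (torusGraph d L).edgeFinset, Sym2.lift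
          ⟨fun x y => corrSt L n A 2 x y, fun x y => corrSt_symm L n A 2 x y⟩ e := by
  rw [map_sum, Complex.re_sum, mul_sum, mul_sum, mul_sum, ← sum_add_distrib, ← sum_add_distrib]
  refine sum_congr rfl fun e _ => ?_
  induction e using Sym2.ind with
  | h x y =>
    simp only [Sym2.lift_mk, map_add, LinearMap.map_smul, smul_eq_mul, Complex.add_re,
      Complex.re_ofReal_mul, re_groundStateFunctional_spinBond_state]

/-- `|Re ω_A(W_L)| ≤ |Λ| ε` for the tracial ground state of ANY Hermitian `A` (no translation
invariance needed): each translate has `|Re ω_A(τ_v w_L)| ≤ ‖τ_v w_L‖ ≤ ‖w_L‖ ≤ ε`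
(`abs_re_groundStateFunctional_le_norm`, `norm_reindexOp_le`). [folklore] -/
private theorem abs_re_gsf_W_le' (L : ℕ) [NeZero L] {A : Op (TorusSite 2 L) (1 + 1)} (hA : A.IsHermitian)
    (𝒲 : AdmissibleW₀ ε R) : |(A.groundStateFunctional (𝒲.W L)).re| ≤ (L : ℝ) ^ 2 * ε := by
  unfold W
  rw [map_sum, Complex.re_sum]
  refine (Finset.abs_sum_le_sum_abs _ _).trans ?_
  have hterm : ∀ v ∈ (Finset.univ : Finset (TorusSite 2 L)),
      |(A.groundStateFunctional (reindexOp (Equiv.addRight v) (𝒲.w L))).re| ≤ ε := fun v _ =>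
    (abs_re_groundStateFunctional_le_norm hA _).trans
      ((norm_reindexOp_le _ _).trans (𝒲.norm_le L))
  refine (Finset.sum_le_sum hterm).trans ?_
  rw [Finset.sum_const, Finset.card_univ, nsmul_eq_mul, card_torusSite_two]

/-- **F3e (Kubo′)** `|e'₃| ≤ e'₁ + ε` on even tori `L = 2k`, `k ≥ 2`: Kubo's two rotations
`U₁ = ⨂Vᴴ` (`1 ↔ 3` interchange, `U₁ H_L U₁ᴴ = -Σ_E(b³ + b²)`) and `U₂U₁` (`U₂` = the `π`-rotation
about the `2`-axis on the odd sublattice, `U₂U₁ H_L (U₂U₁)ᴴ = -Σ_E(-b³ + b²)`) as in the tree's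
`kubo_xy_bondCorr_abs_le_holds`; the variational principle `E₀(H') = E₀(U H' Uᴴ) ≤ Re ω'(U H' Uᴴ)`
in the PERTURBED tracial ground state `ω'`; the two `W` terms cost `|Re ω'(W_L)| ≤ |Λ|ε` and
`|Re ω'(U W_L Uᴴ)| = |Re ω_{UᴴH'U}(W_L)| ≤ |Λ|ε` (`groundStateFunctional_unitary_conj`,
`abs_re_gsf_W_le'`); pairs = edges for `L ≠ 2`. [KLS 1988 PRL after eq. (4); Kubo 1988] [cite: KLS1988PRL, after eq. (4)] [cite: Kubo1988PRL] -/
theorem kubo_state' (𝒲 : AdmissibleW₀ ε R) (k : ℕ) (hk : 2 ≤ k) [NeZero (2 * k)] :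
    |𝒲.bondCorr (2 * k) 2| ≤ 𝒲.bondCorr (2 * k) 0 + ε := by
  have hL : 2 ≤ 2 * k := by omega
  have hL3 : 2 * k ≠ 2 := by omega
  have hLpos' : (0 : ℝ) < ((2 * k : ℕ) : ℝ) := by exact_mod_cast (show 0 < 2 * k by omega)
  set L := 2 * k with hLdef
  have hH := 𝒲.H_isHermitian L
  set E := (torusGraph 2 L).edgeFinset with hE
  set g : Fin 3 → Sym2 (TorusSite 2 L) → ℝ := fun α =>
    Sym2.lift ⟨fun x y => 𝒲.corr L α x y, fun x y => corrSt_symm L 1 (𝒲.H L) α x y⟩ with hg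
  -- the bond-sum operators `B(a,b,c) = Σ_E (a b⁰ + b b¹ + c b²)`
  set B : ℝ → ℝ → ℝ → Op (TorusSite 2 L) (1 + 1) := fun a b c =>
    ∑ e ∈ E, Sym2.lift ⟨fun x y => (a : ℂ) • spinBond 1 0 x y + (b : ℂ) • spinBond 1 1 x y +
      (c : ℂ) • spinBond 1 2 x y, fun x y => by simp only [spinBond_comm]⟩ e with hB
  have hωB : ∀ a b c : ℝ, ((𝒲.H L).groundStateFunctional (B a b c)).re =
      a * ∑ e ∈ E, g 0 e + b * ∑ e ∈ E, g 1 e + c * ∑ e ∈ E, g 2 e :=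
    fun a b c => re_gsf_bondSum_state L 1 (𝒲.H L) a b c
  have hHB : xyTorus 2 L 1 = B (-1) (-1) 0 := xyTorus_eq_bondSum L 1
  -- (1) the perturbed ground energy
  have hE0 : (𝒲.H L).groundEnergy =
      -(∑ e ∈ E, g 0 e) - ∑ e ∈ E, g 1 e + ((𝒲.H L).groundStateFunctional (𝒲.W L)).re := by
    have h := congrArg Complex.re (groundStateFunctional_hamiltonian hH)
    rw [Complex.ofReal_re] at h
    rw [← h]
    change ((𝒲.H L).groundStateFunctional (xyTorus 2 L 1 + 𝒲.W L)).re = _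
    rw [map_add, Complex.add_re, hHB, hωB]
    ring
  -- (2) the single-site rotations (verbatim from the tree's Kubo discharge)
  obtain ⟨V, hV, hV', hVz, hVx, hVy⟩ := exists_unitary_conj_spinZ_eq_spinX 1
  have hx : Vᴴ * spinX 1 * V = SpinOperators.spinZ 1 := by
    rw [← hVz, ← mul_assoc, ← mul_assoc, hV', one_mul, mul_assoc, hV', mul_one]
  have hy : Vᴴ * spinY 1 * V = spinY 1 := by
    conv_lhs => rw [← hVy]
    rw [← mul_assoc, ← mul_assoc, hV', one_mul, mul_assoc, hV', mul_one]
  set Rm := V * V with hR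
  have hRR : Rm * Rmᴴ = 1 := by
    rw [hR, conjTranspose_mul, mul_assoc, ← mul_assoc V Vᴴ, hV, one_mul, hV]
  have hRR' : Rmᴴ * Rm = 1 := by
    rw [hR, conjTranspose_mul, mul_assoc, ← mul_assoc Vᴴ V, hV', one_mul, hV']
  have hRz : Rm * SpinOperators.spinZ 1 * Rmᴴ = -SpinOperators.spinZ 1 := by
    rw [hR, conjTranspose_mul, show V * V * SpinOperators.spinZ 1 * (Vᴴ * Vᴴ) =
      V * (V * SpinOperators.spinZ 1 * Vᴴ) * Vᴴ by simp only [mul_assoc], hVz, hVx]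
  have hRy : Rm * spinY 1 * Rmᴴ = spinY 1 := by
    rw [hR, conjTranspose_mul, show V * V * spinY 1 * (Vᴴ * Vᴴ) =
      V * (V * spinY 1 * Vᴴ) * Vᴴ by simp only [mul_assoc], hVy, hVy]
  -- (3) `U₁ = ⨂ Vᴴ`: `U₁ H_L U₁ᴴ = B 0 (-1) (-1)`
  set u₁ : TorusSite 2 L → Matrix (Fin (1 + 1)) (Fin (1 + 1)) ℂ := fun _ => Vᴴ with hu₁
  have hu₁a : ∀ z, u₁ z * (u₁ z)ᴴ = 1 := fun _ => by rw [hu₁, conjTranspose_conjTranspose, hV']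
  have hu₁b : ∀ z, (u₁ z)ᴴ * u₁ z = 1 := fun _ => by rw [hu₁, conjTranspose_conjTranspose, hV]
  have hb0 : ∀ x y : TorusSite 2 L,
      productOp u₁ * spinBond 1 0 x y * (productOp u₁)ᴴ = spinBond 1 2 x y := by
    intro x y
    rw [productOp_conj_spinBond hu₁a hu₁b, spinVec_zero, hu₁]
    simp only [conjTranspose_conjTranspose, hx]
    rfl
  have hb1 : ∀ x y : TorusSite 2 L,
      productOp u₁ * spinBond 1 1 x y * (productOp u₁)ᴴ = spinBond 1 1 x y := by
    intro x y
    rw [productOp_conj_spinBond hu₁a hu₁b, spinVec_one, hu₁]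
    simp only [conjTranspose_conjTranspose, hy]
    rfl
  have hH₁ : productOp u₁ * xyTorus 2 L 1 * (productOp u₁)ᴴ = B 0 (-1) (-1) := by
    rw [hHB, hB]
    simp only [mul_sum, sum_mul]
    refine sum_congr rfl fun e _ => ?_
    induction e using Sym2.ind with
    | h x y =>
      simp only [Sym2.lift_mk, mul_add, add_mul, mul_smul_comm, smul_mul_assoc, hb0, hb1,
        Complex.ofReal_neg, Complex.ofReal_one, Complex.ofReal_zero, zero_smul, add_zero, zero_add]
      abel
  -- (4) `U₂ = Rm` on the odd sublattice: `U₂ (B 0 (-1) (-1)) U₂ᴴ = B 0 (-1) 1`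
  set par : TorusSite 2 L → ZMod 2 := fun x =>
    ∑ j, ZMod.castHom (dvd_mul_right 2 k) (ZMod 2) (x j) with hpar
  set u₂ : TorusSite 2 L → Matrix (Fin (1 + 1)) (Fin (1 + 1)) ℂ :=
    fun z => if par z = 0 then 1 else Rm with hu₂
  have hu₂a : ∀ z, u₂ z * (u₂ z)ᴴ = 1 := by
    intro z; simp only [hu₂]; split_ifs
    · rw [conjTranspose_one, mul_one]
    · exact hRR
  have hu₂b : ∀ z, (u₂ z)ᴴ * u₂ z = 1 := by
    intro z; simp only [hu₂]; split_ifs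
    · rw [conjTranspose_one, mul_one]
    · exact hRR'
  set sgn : TorusSite 2 L → ℂ := fun z => if par z = 0 then 1 else -1 with hsgn
  have hu₂z : ∀ z, u₂ z * SpinOperators.spinZ 1 * (u₂ z)ᴴ = sgn z • SpinOperators.spinZ 1 := by
    intro z; simp only [hu₂, hsgn]; split_ifs
    · rw [conjTranspose_one, mul_one, one_mul, one_smul]
    · rw [hRz, neg_one_smul]
  have hu₂y : ∀ z, u₂ z * spinY 1 * (u₂ z)ᴴ = spinY 1 := by
    intro z; simp only [hu₂]; split_ifs
    · rw [conjTranspose_one, mul_one, one_mul]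
    · exact hRy
  have hedge : ∀ e ∈ E, ∀ x y, e = s(x, y) → sgn x * sgn y = -1 := by
    intro e he x y hexy
    subst hexy
    rw [hE, SimpleGraph.mem_edgeFinset, SimpleGraph.mem_edgeSet, torusGraph_adj_iff] at he
    have h01 : ∀ t : ZMod 2, t = 0 ∨ t = 1 := by decide
    have key : ∀ x' : TorusSite 2 L, ∀ i, sgn x' * sgn (x' + Pi.single i 1) = -1 := by
      intro x' i
      have hp : par (x' + Pi.single i 1) = par x' + 1 := torusParity_add_single k x' i
      simp only [hsgn, hp]
      rcases h01 (par x') with h0 | h1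
      · rw [if_pos h0, if_neg (by rw [h0]; decide), one_mul]
      · rw [if_neg (by rw [h1]; decide), if_pos (by rw [h1]; decide), mul_one]
    obtain ⟨-, ⟨i, rfl⟩ | ⟨i, rfl⟩⟩ := he
    · exact key x i
    · rw [mul_comm]; exact key y i
  have hc2 : ∀ x y : TorusSite 2 L, sgn x * sgn y = -1 →
      productOp u₂ * spinBond 1 2 x y * (productOp u₂)ᴴ = -spinBond 1 2 x y := by
    intro x y hxy
    rw [productOp_conj_spinBond hu₂a hu₂b, spinVec_two, hu₂z, hu₂z, onSite_smul', onSite_smul',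
      smul_mul_smul_comm, smul_mul_smul_comm, mul_comm (sgn y) (sgn x), hxy, spinBond]
    simp only [neg_smul, one_smul]
    rw [← neg_add, smul_neg]
    rfl
  have hc1 : ∀ x y : TorusSite 2 L,
      productOp u₂ * spinBond 1 1 x y * (productOp u₂)ᴴ = spinBond 1 1 x y := by
    intro x y
    rw [productOp_conj_spinBond hu₂a hu₂b, spinVec_one, hu₂y, hu₂y, spinBond]
    rfl
  have hH₂ : productOp u₂ * B 0 (-1) (-1) * (productOp u₂)ᴴ = B 0 (-1) 1 := by
    rw [hB]
    simp only [mul_sum, sum_mul]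
    refine sum_congr rfl fun e he => ?_
    induction e using Sym2.ind with
    | h x y =>
      have hs := hedge _ he x y rfl
      simp only [Sym2.lift_mk, mul_add, add_mul, Complex.ofReal_neg, Complex.ofReal_one,
        Complex.ofReal_zero, zero_smul, zero_add, neg_smul, one_smul, mul_neg, neg_mul, hc1,
        hc2 x y hs, neg_neg]
  -- the composite rotation
  have hUUa : productOp u₂ * productOp u₁ * (productOp u₂ * productOp u₁)ᴴ = 1 := by
    rw [conjTranspose_mul, show productOp u₂ * productOp u₁ * ((productOp u₁)ᴴ * (productOp u₂)ᴴ) =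
      productOp u₂ * (productOp u₁ * (productOp u₁)ᴴ) * (productOp u₂)ᴴ by simp only [mul_assoc],
      productOp_mul_conjTranspose hu₁a, mul_one, productOp_mul_conjTranspose hu₂a]
  have hUUb : (productOp u₂ * productOp u₁)ᴴ * (productOp u₂ * productOp u₁) = 1 := by
    rw [conjTranspose_mul, show (productOp u₁)ᴴ * (productOp u₂)ᴴ * (productOp u₂ * productOp u₁) =
      (productOp u₁)ᴴ * ((productOp u₂)ᴴ * productOp u₂) * productOp u₁ by simp only [mul_assoc],
      productOp_conjTranspose_mul hu₂b, mul_one, productOp_conjTranspose_mul hu₁b]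
  have hH₂' : productOp u₂ * productOp u₁ * xyTorus 2 L 1 * (productOp u₂ * productOp u₁)ᴴ =
      B 0 (-1) 1 := by
    rw [conjTranspose_mul, show productOp u₂ * productOp u₁ * xyTorus 2 L 1 *
        ((productOp u₁)ᴴ * (productOp u₂)ᴴ) =
      productOp u₂ * (productOp u₁ * xyTorus 2 L 1 * (productOp u₁)ᴴ) * (productOp u₂)ᴴ by
        simp only [mul_assoc], hH₁, hH₂]
  -- (5) the variational step in the PERTURBED state, for a unitary `U` with `U H_L Uᴴ = B 0 (-1) c`
  have step : ∀ (U : Op (TorusSite 2 L) (1 + 1)) (c : ℝ), U * Uᴴ = 1 → Uᴴ * U = 1 →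
      U * xyTorus 2 L 1 * Uᴴ = B 0 (-1) c →
      -(c * ∑ e ∈ E, g 2 e) ≤ ∑ e ∈ E, g 0 e + 2 * ((L : ℝ) ^ 2 * ε) := by
    intro U c hUa hUb hUH
    have hUmem : U ∈ Matrix.unitaryGroup (TensorIndex (TorusSite 2 L) (1 + 1)) ℂ :=
      Matrix.mem_unitaryGroup_iff.2 hUa
    have hconjH : U * 𝒲.H L * Uᴴ = B 0 (-1) c + U * 𝒲.W L * Uᴴ := by
      change U * (xyTorus 2 L 1 + 𝒲.W L) * Uᴴ = _
      rw [mul_add, add_mul, hUH]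
    have hHermc : (U * 𝒲.H L * Uᴴ).IsHermitian := isHermitian_mul_mul_conjTranspose _ hH
    have hvar := groundEnergy_le_groundStateFunctional_re hH hHermc
    rw [Matrix.groundEnergy_unitary_conj hUmem, hE0, hconjH, map_add, Complex.add_re, hωB] at hvar
    have hW1 := abs_re_gsf_W_le' L hH 𝒲
    have hW2 : |((𝒲.H L).groundStateFunctional (U * 𝒲.W L * Uᴴ)).re| ≤ (L : ℝ) ^ 2 * ε := by
      have hconj : U * (Uᴴ * 𝒲.H L * U) * Uᴴ = 𝒲.H L := by
        rw [show U * (Uᴴ * 𝒲.H L * U) * Uᴴ = (U * Uᴴ) * 𝒲.H L * (U * Uᴴ) by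
          simp only [mul_assoc], hUa, one_mul, mul_one]
      have h := groundStateFunctional_unitary_conj hUa hUb (A := Uᴴ * 𝒲.H L * U) (𝒲.W L)
      rw [hconj] at h
      rw [h]
      exact abs_re_gsf_W_le' L (isHermitian_conjTranspose_mul_mul U hH) 𝒲
    rw [abs_le] at hW1 hW2
    linarith [hW1.1, hW2.2]
  have hm := step (productOp u₁) (-1) (productOp_mul_conjTranspose hu₁a)
    (productOp_conjTranspose_mul hu₁b) hH₁
  have hp := step (productOp u₂ * productOp u₁) 1 hUUa hUUb hH₂'
  have habs : |∑ e ∈ E, g 2 e| ≤ ∑ e ∈ E, g 0 e + 2 * ((L : ℝ) ^ 2 * ε) := by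
    rw [abs_le]; constructor <;> linarith
  -- (6) pairs versus edges (`L ≥ 4`)
  have h0 : ∑ x : TorusSite 2 L, ∑ i : Fin 2, 𝒲.corr L 0 x (x + Pi.single i 1) =
      ∑ e ∈ E, g 0 e := by
    have h := sum_pairs_eq_sum_edgeFinset L hL (g 0)
    rw [if_neg hL3, one_mul] at h
    exact h
  have h2 : ∑ x : TorusSite 2 L, ∑ i : Fin 2, 𝒲.corr L 2 x (x + Pi.single i 1) =
      ∑ e ∈ E, g 2 e := by
    have h := sum_pairs_eq_sum_edgeFinset L hL (g 2)
    rw [if_neg hL3, one_mul] at h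
    exact h
  rw [bondCorr, bondCorr, h0, h2]
  have hLpos : (0 : ℝ) < 2 * (L : ℝ) ^ 2 := by positivity
  rw [abs_div, abs_of_pos hLpos]
  calc |∑ e ∈ E, g 2 e| / (2 * (L : ℝ) ^ 2)
      ≤ (∑ e ∈ E, g 0 e + 2 * ((L : ℝ) ^ 2 * ε)) / (2 * (L : ℝ) ^ 2) :=
        div_le_div_of_nonneg_right habs hLpos.le
    _ = (∑ e ∈ E, g 0 e) / (2 * (L : ℝ) ^ 2) + ε := by
        rw [add_div, mul_div_assoc]
        congr 1
        field_simp

end AdmissibleW₀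




/-! ## C.1e (LIT g10, W-P2) Locality bookkeeping for the double commutator with `W` — discharge of F3b

The ring-bracket / support / spin-norm kit below is COPIED (it is `private` at its source) from the
summit-side `Summits/HubbardSuperconductivity/HubbardSuperconductivity/Theorems/
AposterioriCapRgXYOrderOpennessLargeSpinDoubleCommutatorW.lean` (`stub_doubleCommutatorW`, route
AposterioriCapRg, line `feynman-sector-gap`), which proves the same KLS88 eq. (13) locality bound
for `LocalRuleSum` perturbations; here it is re-run for the cell's class `AdmissibleW₀ ε R`
(translates of ONE rule supported on the box `[0,R)²`, `‖w‖ ≤ ε`, spin ½). -/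

section LocalityKit

variable {m : Type*} [Fintype m]

/-- `⁅c • A, B⁆ = c • ⁅A, B⁆`. [folklore] -/
private theorem mx_smul_lie (c : ℂ) (A B : Matrix m m ℂ) : ⁅c • A, B⁆ = c • ⁅A, B⁆ := by
  rw [Ring.lie_def, Ring.lie_def, smul_mul_assoc, mul_smul_comm, smul_sub]

/-- `⁅A, c • B⁆ = c • ⁅A, B⁆`. [folklore] -/
private theorem mx_lie_smul (c : ℂ) (A B : Matrix m m ℂ) : ⁅A, c • B⁆ = c • ⁅A, B⁆ := by
  rw [Ring.lie_def, Ring.lie_def, mul_smul_comm, smul_mul_assoc, smul_sub]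

/-- `⁅Σ_i A_i, C⁆ = Σ_i ⁅A_i, C⁆`. [folklore] -/
private theorem mx_sum_lie {ι : Type*} (s : Finset ι) (A : ι → Matrix m m ℂ) (C : Matrix m m ℂ) :
    ⁅∑ i ∈ s, A i, C⁆ = ∑ i ∈ s, ⁅A i, C⁆ := by
  simp only [Ring.lie_def, Finset.sum_mul, Finset.mul_sum, Finset.sum_sub_distrib]

/-- `⁅C, Σ_i A_i⁆ = Σ_i ⁅C, A_i⁆`. [folklore] -/
private theorem mx_lie_sum {ι : Type*} (s : Finset ι) (A : ι → Matrix m m ℂ) (C : Matrix m m ℂ) :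
    ⁅C, ∑ i ∈ s, A i⁆ = ∑ i ∈ s, ⁅C, A i⁆ := by
  simp only [Ring.lie_def, Finset.sum_mul, Finset.mul_sum, Finset.sum_sub_distrib]

/-- `⁅A, 0⁆ = 0`. [folklore] -/
private theorem mx_lie_zero (A : Matrix m m ℂ) : ⁅A, (0 : Matrix m m ℂ)⁆ = 0 := by
  rw [Ring.lie_def, mul_zero, zero_mul, sub_zero]

variable [DecidableEq m]

/-- `‖⁅A, B⁆‖ ≤ 2 ‖A‖ ‖B‖` (L²-operator norm). [folklore] -/
private theorem norm_lie_le (A B : Matrix m m ℂ) : ‖⁅A, B⁆‖ ≤ 2 * ‖A‖ * ‖B‖ := by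
  rw [Ring.lie_def]
  calc ‖A * B - B * A‖ ≤ ‖A * B‖ + ‖B * A‖ := norm_sub_le _ _
    _ ≤ ‖A‖ * ‖B‖ + ‖B‖ * ‖A‖ := add_le_add (norm_mul_le _ _) (norm_mul_le _ _)
    _ = 2 * ‖A‖ * ‖B‖ := by ring

end LocalityKit

section Locality

variable {Λ : Type*} [Fintype Λ] [DecidableEq Λ]

/-- `𝔄_X` is closed under commutators. [folklore] -/
private theorem isSupportedOn_lie {q : ℕ} {A B : Op Λ q} {X : Finset Λ} (hA : IsSupportedOn A X)
    (hB : IsSupportedOn B X) : IsSupportedOn ⁅A, B⁆ X := by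
  rw [Ring.lie_def, sub_eq_add_neg, ← neg_one_smul ℂ (B * A)]
  exact (IsSupportedOn.mul_holds hA hB).add ((IsSupportedOn.mul_holds hB hA).smul _)

/-- Locality for commutators: `[A, B] = 0` for `A ∈ 𝔄_X`, `B ∈ 𝔄_Y`, `X ∩ Y = ∅`. [folklore] -/
private theorem lie_eq_zero_of_disjoint {q : ℕ} {A B : Op Λ q} {X Y : Finset Λ}
    (hA : IsSupportedOn A X) (hB : IsSupportedOn B Y) (h : Disjoint X Y) : ⁅A, B⁆ = 0 :=
  (commute_of_disjoint_holds hA hB h).lie_eq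

/-- `S^α_x ∈ 𝔄_{{x}}`. [folklore] -/
private theorem isSupportedOn_siteSpin (n : ℕ) (x : Λ) (α : Fin 3) :
    IsSupportedOn (siteSpin n x α : Op Λ (n + 1)) {x} :=
  isSupportedOn_onSite_holds x (spinVec n α)

open scoped MatrixOrder in
/-- `‖S^γ_x‖ ≤ S = n/2` (L²-operator norm): `0 ≤ (S^γ_x)² ≤ S²·1` in the Loewner order
(`posSemidef_sq_smul_one_sub_siteSpin_sq`), monotonicity of the norm on the positive cone, and
`‖Tᴴ T‖ = ‖T‖²`. [folklore] -/
private theorem norm_siteSpin_le (n : ℕ) (x : Λ) (γ : Fin 3) :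
    ‖(siteSpin n x γ : Op Λ (n + 1))‖ ≤ (n : ℝ) / 2 := by
  letI : CStarAlgebra (Op Λ (n + 1)) := {}
  set T : Op Λ (n + 1) := siteSpin n x γ
  have hH : Tᴴ = T := (siteSpin_isHermitian n x γ).eq
  have h0 : (0 : Op Λ (n + 1)) ≤ T * T := by
    rw [Matrix.nonneg_iff_posSemidef]
    nth_rewrite 1 [← hH]
    exact posSemidef_conjTranspose_mul_self T
  have h1 : T * T ≤ (((n : ℂ) / 2) ^ 2) • (1 : Op Λ (n + 1)) := by
    rw [Matrix.le_iff]
    exact posSemidef_sq_smul_one_sub_siteSpin_sq n x γ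
  have h2 : ‖T * T‖ ≤ ‖(((n : ℂ) / 2) ^ 2) • (1 : Op Λ (n + 1))‖ :=
    CStarAlgebra.norm_le_norm_of_nonneg_of_le h0 h1
  have h3 : ‖T * T‖ = ‖T‖ * ‖T‖ := by
    nth_rewrite 1 [← hH]
    exact Matrix.l2_opNorm_conjTranspose_mul_self T
  have h4 : ‖(((n : ℂ) / 2) ^ 2) • (1 : Op Λ (n + 1))‖ = ((n : ℝ) / 2) ^ 2 := by
    rw [norm_smul, CStarRing.norm_one, mul_one,
      show ((n : ℂ) / 2) ^ 2 = ((((n : ℝ) / 2) ^ 2 : ℝ) : ℂ) by push_cast; ring, Complex.norm_real,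
      Real.norm_of_nonneg (by positivity)]
  rw [h3, h4] at h2
  have hS : (0 : ℝ) ≤ (n : ℝ) / 2 := by positivity
  nlinarith [norm_nonneg T, h2, hS]

/-- **The double sum over one local rule** (with a norm budget `δ`): for `w ∈ 𝔄_B`, `‖w‖ ≤ δ`,
`Σ_x Σ_y ‖[S^α_x, [w, S^α_y]]‖ ≤ n² δ (#B)²`. [cite: KLS1988JSP, eq. (13)] -/
theorem sum_sum_norm_lie_lie_le (n : ℕ) {B : Finset Λ} {w : Op Λ (n + 1)}
    (hw : IsSupportedOn w B) {δ : ℝ} (hwδ : ‖w‖ ≤ δ) (α : Fin 3) :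
    ∑ x : Λ, ∑ y : Λ, ‖⁅(siteSpin n x α : Op Λ (n + 1)), ⁅w, siteSpin n y α⁆⁆‖ ≤
      (n : ℝ) ^ 2 * δ * (B.card : ℝ) ^ 2 := by
  have hδ : 0 ≤ δ := (norm_nonneg _).trans hwδ
  -- locality
  have hin0 : ∀ y : Λ, y ∉ B → ⁅w, (siteSpin n y α : Op Λ (n + 1))⁆ = 0 := fun y hy =>
    lie_eq_zero_of_disjoint hw (isSupportedOn_siteSpin n y α)
      (Finset.disjoint_singleton_right.2 hy)
  have hin : ∀ y : Λ, y ∈ B → IsSupportedOn ⁅w, (siteSpin n y α : Op Λ (n + 1))⁆ B :=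
      fun y hy =>
    isSupportedOn_lie hw (IsSupportedOn.mono_holds (isSupportedOn_siteSpin n y α)
      (Finset.singleton_subset_iff.2 hy))
  have hout0 : ∀ x : Λ, x ∉ B → ∀ y : Λ,
      ⁅(siteSpin n x α : Op Λ (n + 1)), ⁅w, siteSpin n y α⁆⁆ = 0 := by
    intro x hx y
    by_cases hy : y ∈ B
    · exact lie_eq_zero_of_disjoint (isSupportedOn_siteSpin n x α) (hin y hy)
        (Finset.disjoint_singleton_left.2 hx)
    · rw [hin0 y hy, mx_lie_zero]
  -- the norm of one term
  have hS : (0 : ℝ) ≤ (n : ℝ) / 2 := by positivity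
  have hterm : ∀ x y : Λ,
      ‖⁅(siteSpin n x α : Op Λ (n + 1)), ⁅w, siteSpin n y α⁆⁆‖ ≤ (n : ℝ) ^ 2 * δ := by
    intro x y
    calc ‖⁅(siteSpin n x α : Op Λ (n + 1)), ⁅w, siteSpin n y α⁆⁆‖
        ≤ 2 * ‖(siteSpin n x α : Op Λ (n + 1))‖ * ‖⁅w, (siteSpin n y α : Op Λ (n + 1))⁆‖ :=
          norm_lie_le _ _
      _ ≤ 2 * ‖(siteSpin n x α : Op Λ (n + 1))‖ * (2 * ‖w‖ * ‖(siteSpin n y α : Op Λ (n + 1))‖) :=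
          mul_le_mul_of_nonneg_left (norm_lie_le _ _)
            (mul_nonneg zero_le_two (norm_nonneg _))
      _ ≤ 2 * ((n : ℝ) / 2) * (2 * δ * ((n : ℝ) / 2)) :=
          mul_le_mul (mul_le_mul_of_nonneg_left (norm_siteSpin_le n x α) zero_le_two)
            (mul_le_mul (mul_le_mul_of_nonneg_left hwδ zero_le_two) (norm_siteSpin_le n y α)
              (norm_nonneg _) (by positivity))
            (mul_nonneg (mul_nonneg zero_le_two (norm_nonneg _)) (norm_nonneg _))
            (mul_nonneg zero_le_two hS)
      _ = (n : ℝ) ^ 2 * δ := by ring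
  -- restrict both sums to the support and count
  calc ∑ x : Λ, ∑ y : Λ, ‖⁅(siteSpin n x α : Op Λ (n + 1)), ⁅w, siteSpin n y α⁆⁆‖
      = ∑ x ∈ B, ∑ y : Λ, ‖⁅(siteSpin n x α : Op Λ (n + 1)), ⁅w, siteSpin n y α⁆⁆‖ := by
        refine (Finset.sum_subset (Finset.subset_univ B) fun x _ hx => ?_).symm
        simp only [hout0 x hx, norm_zero, Finset.sum_const_zero]
    _ = ∑ x ∈ B, ∑ y ∈ B, ‖⁅(siteSpin n x α : Op Λ (n + 1)), ⁅w, siteSpin n y α⁆⁆‖ := by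
        refine Finset.sum_congr rfl fun x _ => ?_
        refine (Finset.sum_subset (Finset.subset_univ B) fun y _ hy => ?_).symm
        rw [hin0 y hy, mx_lie_zero, norm_zero]
    _ ≤ ∑ _x ∈ B, ∑ _y ∈ B, (n : ℝ) ^ 2 * δ :=
        Finset.sum_le_sum fun x _ => Finset.sum_le_sum fun y _ => hterm x y
    _ = (n : ℝ) ^ 2 * δ * (B.card : ℝ) ^ 2 := by
        simp only [Finset.sum_const, nsmul_eq_mul]
        ring

end Locality

/-- The box `[0,R)²` has at most `R²` sites. [folklore] -/
private theorem card_box_le (L R : ℕ) [NeZero L] : (box L R).card ≤ R ^ 2 := by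
  classical
  have hsub : box L R ⊆ Fintype.piFinset fun _ : Fin 2 =>
      (univ.filter fun c : ZMod L => c.val < R) := by
    intro x hx
    rw [Fintype.mem_piFinset]
    intro i
    simp only [box, mem_filter, mem_univ, true_and] at hx ⊢
    exact hx i
  refine (card_le_card hsub).trans ?_
  rw [Fintype.card_piFinset, prod_const, card_univ, Fintype.card_fin]
  have h1 : (univ.filter fun c : ZMod L => c.val < R).card ≤ R := by
    calc (univ.filter fun c : ZMod L => c.val < R).card ≤ (Finset.range R).card :=
          Finset.card_le_card_of_injOn (fun c : ZMod L => c.val)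
            (fun c hc => Finset.mem_coe.2 (Finset.mem_range.2
              (Finset.mem_filter.1 (Finset.mem_coe.1 hc)).2))
            (fun a _ b _ h => ZMod.val_injective L h)
      _ = R := Finset.card_range R
  exact Nat.pow_le_pow_left h1 2

namespace AdmissibleW₀

variable {ε : ℝ} {R : ℕ}

/-- The translate `τ_v w_L` is supported on the translated box. [folklore] -/
private theorem isSupportedOn_translate (𝒲 : AdmissibleW₀ ε R) (L : ℕ) [NeZero L] (v : TorusSite 2 L) :
    IsSupportedOn (reindexOp (Equiv.addRight v) (𝒲.w L))
      ((box L R).map (Equiv.addRight v).toEmbedding) := by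
  obtain ⟨B, hB⟩ := 𝒲.supp L
  rw [← hB, reindexOp_localOp]
  exact ⟨_, rfl⟩

/-- One real-coefficient mode `M_c = Σ_x c_x S¹_x`, `|c_x| ≤ 1`, against `W_L` in ANY Hermitian
state: `|Re ω_A([M_c, [W_L, M_c]])| ≤ R⁴ ε |Λ|`. [cite: KLS1988JSP, eq. (13)] -/
theorem abs_re_gsf_lie_mode_lie_W_le (𝒲 : AdmissibleW₀ ε R) (hε : 0 ≤ ε) (L : ℕ) [NeZero L]
    {A : Op (TorusSite 2 L) (1 + 1)} (hA : A.IsHermitian) (c : TorusSite 2 L → ℝ)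
    (hc : ∀ x, |c x| ≤ 1) :
    |(A.groundStateFunctional
        ⁅(∑ x : TorusSite 2 L, (c x : ℂ) • (siteSpin 1 x 0 : Op (TorusSite 2 L) (1 + 1))),
          ⁅𝒲.W L,
            ∑ y : TorusSite 2 L, (c y : ℂ) • (siteSpin 1 y 0 : Op (TorusSite 2 L) (1 + 1))⁆⁆).re| ≤
      (R : ℝ) ^ 4 * ε * (L : ℝ) ^ 2 := by
  set τw : TorusSite 2 L → Op (TorusSite 2 L) (1 + 1) :=
    fun v => reindexOp (Equiv.addRight v) (𝒲.w L) with hτw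
  have hWsum : 𝒲.W L = ∑ v : TorusSite 2 L, τw v := rfl
  -- bilinear expansion
  have hXA : ⁅𝒲.W L, ∑ y : TorusSite 2 L, (c y : ℂ) • (siteSpin 1 y 0 : Op (TorusSite 2 L) (1 + 1))⁆ =
      ∑ v : TorusSite 2 L, ∑ y : TorusSite 2 L,
        (c y : ℂ) • ⁅τw v, (siteSpin 1 y 0 : Op (TorusSite 2 L) (1 + 1))⁆ := by
    rw [hWsum, mx_sum_lie]
    refine sum_congr rfl fun v _ => ?_
    rw [mx_lie_sum]
    refine sum_congr rfl fun y _ => ?_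
    rw [mx_lie_smul]
  have hD : ⁅(∑ x : TorusSite 2 L, (c x : ℂ) • (siteSpin 1 x 0 : Op (TorusSite 2 L) (1 + 1))),
      ⁅𝒲.W L, ∑ y : TorusSite 2 L, (c y : ℂ) • (siteSpin 1 y 0 : Op (TorusSite 2 L) (1 + 1))⁆⁆ =
      ∑ x : TorusSite 2 L, ∑ v : TorusSite 2 L, ∑ y : TorusSite 2 L, ((c x : ℂ) * (c y : ℂ)) •
        ⁅(siteSpin 1 x 0 : Op (TorusSite 2 L) (1 + 1)), ⁅τw v, siteSpin 1 y 0⁆⁆ := by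
    rw [hXA, mx_sum_lie]
    refine sum_congr rfl fun x _ => ?_
    rw [mx_smul_lie, mx_lie_sum, Finset.smul_sum]
    refine sum_congr rfl fun v _ => ?_
    rw [mx_lie_sum, Finset.smul_sum]
    refine sum_congr rfl fun y _ => ?_
    rw [mx_lie_smul, smul_smul]
  -- per translate: `ε R⁴`
  have hcentre : ∀ v : TorusSite 2 L, ∑ x : TorusSite 2 L, ∑ y : TorusSite 2 L,
      ‖⁅(siteSpin 1 x 0 : Op (TorusSite 2 L) (1 + 1)), ⁅τw v, siteSpin 1 y 0⁆⁆‖ ≤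
        (R : ℝ) ^ 4 * ε := by
    intro v
    have hcard : (((box L R).map (Equiv.addRight v).toEmbedding).card : ℝ) ≤ (R : ℝ) ^ 2 := by
      rw [Finset.card_map]
      exact_mod_cast card_box_le L R
    have hcard0 : (0 : ℝ) ≤ (((box L R).map (Equiv.addRight v).toEmbedding).card : ℝ) := by
      positivity
    calc _ ≤ ((1 : ℕ) : ℝ) ^ 2 * ε * (((box L R).map (Equiv.addRight v).toEmbedding).card : ℝ) ^ 2 :=
          sum_sum_norm_lie_lie_le 1 (𝒲.isSupportedOn_translate L v)
            ((norm_reindexOp_le _ _).trans (𝒲.norm_le L)) 0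
      _ ≤ ((1 : ℕ) : ℝ) ^ 2 * ε * ((R : ℝ) ^ 2) ^ 2 := by gcongr
      _ = (R : ℝ) ^ 4 * ε := by push_cast; ring
  -- the operator norm of the double commutator
  have hs : ∀ x y : TorusSite 2 L, ‖(c x : ℂ) * (c y : ℂ)‖ ≤ 1 := by
    intro x y
    rw [norm_mul, Complex.norm_real, Complex.norm_real, Real.norm_eq_abs, Real.norm_eq_abs]
    exact mul_le_one₀ (hc x) (abs_nonneg _) (hc y)
  have hnormD : ‖⁅(∑ x : TorusSite 2 L, (c x : ℂ) • (siteSpin 1 x 0 : Op (TorusSite 2 L) (1 + 1))),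
      ⁅𝒲.W L, ∑ y : TorusSite 2 L, (c y : ℂ) • (siteSpin 1 y 0 : Op (TorusSite 2 L) (1 + 1))⁆⁆‖ ≤
      (R : ℝ) ^ 4 * ε * (L : ℝ) ^ 2 := by
    rw [hD]
    refine (norm_sum_le _ _).trans ?_
    refine (Finset.sum_le_sum fun x _ => (norm_sum_le _ _).trans <|
      Finset.sum_le_sum fun v _ => norm_sum_le _ _).trans ?_
    have hpt : ∀ x v y : TorusSite 2 L,
        ‖((c x : ℂ) * (c y : ℂ)) • ⁅(siteSpin 1 x 0 : Op (TorusSite 2 L) (1 + 1)), ⁅τw v, siteSpin 1 y 0⁆⁆‖ ≤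
          ‖⁅(siteSpin 1 x 0 : Op (TorusSite 2 L) (1 + 1)), ⁅τw v, siteSpin 1 y 0⁆⁆‖ := by
      intro x v y
      rw [norm_smul]
      exact mul_le_of_le_one_left (norm_nonneg _) (hs x y)
    refine (Finset.sum_le_sum fun x _ => Finset.sum_le_sum fun v _ =>
      Finset.sum_le_sum fun y _ => hpt x v y).trans ?_
    rw [Finset.sum_comm]
    calc ∑ v : TorusSite 2 L, ∑ x : TorusSite 2 L, ∑ y : TorusSite 2 L,
          ‖⁅(siteSpin 1 x 0 : Op (TorusSite 2 L) (1 + 1)), ⁅τw v, siteSpin 1 y 0⁆⁆‖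
        ≤ ∑ _v : TorusSite 2 L, (R : ℝ) ^ 4 * ε := sum_le_sum fun v _ => hcentre v
      _ = (R : ℝ) ^ 4 * ε * (L : ℝ) ^ 2 := by
          rw [sum_const, card_univ, nsmul_eq_mul, card_torusSite_two]
          ring
  exact (abs_re_groundStateFunctional_le_norm hA _).trans hnormD

/-- **F3b** `|Re ω'([C_q,[W_L,C_q]] + [D_q,[W_L,D_q]])| ≤ 2R⁴ ε |Λ|` (cosine and sine modes have
coefficients of modulus `≤ 1`). [cite: KLS1988JSP, eq. (13)] -/
theorem re_lie_lie_W_abs_le' (𝒲 : AdmissibleW₀ ε R) (hε : 0 ≤ ε) (L : ℕ) [NeZero L]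
    (q : TorusSite 2 L) :
    |((𝒲.H L).groundStateFunctional ⁅xyCosMode L 1 q, ⁅𝒲.W L, xyCosMode L 1 q⁆⁆).re +
        ((𝒲.H L).groundStateFunctional ⁅xySinMode L 1 q, ⁅𝒲.W L, xySinMode L 1 q⁆⁆).re| ≤
      2 * (R : ℝ) ^ 4 * ε * (L : ℝ) ^ 2 := by
  have h1 := 𝒲.abs_re_gsf_lie_mode_lie_W_le hε L (𝒲.H_isHermitian L)
    (fun x => Real.cos (torusPhase L q x)) (fun x => Real.abs_cos_le_one _)
  have h2 := 𝒲.abs_re_gsf_lie_mode_lie_W_le hε L (𝒲.H_isHermitian L)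
    (fun x => Real.sin (torusPhase L q x)) (fun x => Real.abs_sin_le_one _)
  calc _ ≤ |((𝒲.H L).groundStateFunctional ⁅xyCosMode L 1 q, ⁅𝒲.W L, xyCosMode L 1 q⁆⁆).re| +
        |((𝒲.H L).groundStateFunctional ⁅xySinMode L 1 q, ⁅𝒲.W L, xySinMode L 1 q⁆⁆).re| :=
        abs_add_le _ _
    _ ≤ (R : ℝ) ^ 4 * ε * (L : ℝ) ^ 2 + (R : ℝ) ^ 4 * ε * (L : ℝ) ^ 2 := add_le_add h1 h2
    _ = 2 * (R : ℝ) ^ 4 * ε * (L : ℝ) ^ 2 := by ring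

end AdmissibleW₀


/-! ## C.2 The named lattice facts (perturbed analogues of the tree's (S), (SYM), (B), (D)) -/

section Facts

variable {ε : ℝ} {R : ℕ}

/-- **F1 (centring)** — PROVED (§C.1c): `Re ω'(C_q) = Re ω'(D_q) = 0` for `q ≠ 0`: `ω'` is
translation invariant (`H_submatrix_addRight`, `groundStateFunctional_submatrix_comp`) and
`Σ_x cos(p_q·x) = Σ_x sin(p_q·x) = 0` (`sum_cos_torusPhase_site`, `sum_sin_torusPhase_site`). [folklore] -/
private theorem oneMode_centred (𝒲 : AdmissibleW₀ ε R) (L : ℕ) [NeZero L] {q : TorusSite 2 L}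
    (hq : q ≠ 0) :
    ((𝒲.H L).groundStateFunctional (xyCosMode L 1 q)).re = 0 ∧
      ((𝒲.H L).groundStateFunctional (xySinMode L 1 q)).re = 0 :=
  𝒲.oneMode_centred' L hq

/-- **F3a (double commutator of `H_XY`, state-generic)** — PROVED (§C.1b): the tree's
`re_groundStateFunctional_lie_lie_modes` for the tracial ground state of ANY Hamiltonian `A`. [cite: KLS1988JSP, eq. (13)] -/
theorem re_lie_lie_modes_state (L : ℕ) [NeZero L] (hL : 3 ≤ L) (A : Op (TorusSite 2 L) (1 + 1))
    (q : TorusSite 2 L) :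
    (A.groundStateFunctional ⁅xyCosMode L 1 q, ⁅xyTorus 2 L 1, xyCosMode L 1 q⁆⁆).re +
      (A.groundStateFunctional ⁅xySinMode L 1 q, ⁅xyTorus 2 L 1, xySinMode L 1 q⁆⁆).re =
      2 * ∑ i : Fin 2, ∑ z : TorusSite 2 L,
        ((A.groundStateFunctional (siteSpin 1 z 1 * siteSpin 1 (z + Pi.single i 1) 1)).re -
          Real.cos (latticeMomentum L q i) *
            (A.groundStateFunctional (siteSpin 1 z 2 * siteSpin 1 (z + Pi.single i 1) 2)).re) :=
  re_groundStateFunctional_lie_lie_modes_state L 1 hL A q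

/-- **F3b (double commutator of `W`)** `|Re ω'([C_q,[W_L,C_q]] + [D_q,[W_L,D_q]])| ≤ 2R⁴ ε |Λ|`:
`[τ_v w, C_q]` involves only the `R²` sites of `supp τ_v w`, `‖S¹‖ = ½`, `‖w‖ ≤ ε`, and there are
`|Λ|` translates. PROVED (g10, §C.1e `re_lie_lie_W_abs_le'`). [cite: KLS1988JSP, eq. (13)] -/
theorem re_lie_lie_W_abs_le (𝒲 : AdmissibleW₀ ε R) (hε : 0 ≤ ε) (L : ℕ) [NeZero L]
    (q : TorusSite 2 L) :
    |((𝒲.H L).groundStateFunctional ⁅xyCosMode L 1 q, ⁅𝒲.W L, xyCosMode L 1 q⁆⁆).re +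
        ((𝒲.H L).groundStateFunctional ⁅xySinMode L 1 q, ⁅𝒲.W L, xySinMode L 1 q⁆⁆).re| ≤
      2 * (R : ℝ) ^ 4 * ε * (L : ℝ) ^ 2 :=
  𝒲.re_lie_lie_W_abs_le' hε L q

/-- **F3c (S′)** — PROVED (§C.1c): `G'²(x,y) = G'¹(x,y)`: the quarter turn about the 3-axis is
diagonal with entries `(-i)^{Σσ}`, a function of `S³_tot` (`quarterTurn_eq_diagonal`,
`commute_quarterTurn_of_commute_totalSpin_two`), hence commutes with `W_L` (`u1`) and `H_L`; the
tracial state is invariant (`groundStateFunctional_conj_of_commute`; tree pattern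
`xy_groundCorr_two_eq_one_holds`). [cite: KLS1988PRL, after eq. (3)] -/
theorem corr_one_eq_corr_zero (𝒲 : AdmissibleW₀ ε R) (L : ℕ) [NeZero L] (x y : TorusSite 2 L) :
    𝒲.corr L 1 x y = 𝒲.corr L 0 x y :=
  𝒲.corr_one_eq_corr_zero' L x y

/-- **F3d (SYM′)** — PROVED (§C.1c): the bond sums do not depend on the direction — HERE the
swap symmetry of the rule is used: `reindexOp (swapSite L)` fixes `H_L` and `W_L` (`H_submatrix_swap`) and
maps direction-0 bonds to direction-1 bonds (tree pattern `sum_xyGroundCorr_dir_eq`). [folklore] -/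
private theorem bond_dir_symm (𝒲 : AdmissibleWsym ε R) (L : ℕ) [NeZero L] (α : Fin 3) :
    ∑ z : TorusSite 2 L, 𝒲.toAdmissibleW₀.corr L α z (z + Pi.single 0 1) =
      ∑ z : TorusSite 2 L, 𝒲.toAdmissibleW₀.corr L α z (z + Pi.single 1 1) :=
  𝒲.bond_dir_symm' L α

/-- **F3e (Kubo′)** `|e'₃| ≤ e'₁ + ε` on even tori `L = 2k`, `k ≥ 2` (at `L = 2` every edge
arises from two pairs, `sum_pairs_eq_sum_edgeFinset`, and only `|e'₃| ≤ e'₁ + 2ε` holds; the chain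
uses `k ≥ 2` only): Kubo's two unitaries `U_±` (global `1 ↔ 3`
interchange, optionally composed with the staggered `π`-rotation about the 2-axis) satisfy
`U_±ᴴ H_L U_± = −Σ_b (±S³S³ + S²S²)`; they do NOT fix `W_L`, which costs
`|Re ω'(U_±ᴴ W_L U_±) − Re ω'(W_L)| ≤ 2‖W_L‖ ≤ 2|Λ|ε` (tree: `kubo_xy_bondCorr_abs_le_holds`). PROVED (g10, §C.1d `kubo_state'`). [cite: KLS1988PRL, after eq. (4)] [cite: Kubo1988PRL] -/
theorem kubo_state (𝒲 : AdmissibleW₀ ε R) (_hε : 0 ≤ ε) (k : ℕ) (hk : 2 ≤ k) [NeZero (2 * k)] :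
    |𝒲.bondCorr (2 * k) 2| ≤ 𝒲.bondCorr (2 * k) 0 + ε :=
  𝒲.kubo_state' k hk

/-- **F5 (D′)** — PROVED (§C.1c) for `L ≥ 3` (at `L = 2` the pairs/edges factor is `2` and only
`e'₁ ≥ 1/8 − ε` holds; the chain uses `L ≥ 4` only): `E₀(H') ≤ Re ω_{H_L}(H') = E₀(H_L) +
Re ω_{H_L}(W_L) ≤ −|Λ|/2 + |Λ|ε` (variational principle with the unperturbed tracial ground state,
its translation invariance, tree (D) `kls_xy_bondCorr_lower_holds`, `E₀(H_L) = −2Σ_E G¹`) and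
`E₀(H') = Re ω'(H_L) + Re ω'(W_L) = −4|Λ| e'₁ + Re ω'(W_L) ≥ −4|Λ| e'₁ − |Λ|ε` (F3c, translation
invariance of `ω'`, `|Re ω'(w_L)| ≤ ‖w_L‖ ≤ ε`). No sorry. [cite: KLS1988PRL, after eq. (8)] -/
theorem bondCorr_lower (𝒲 : AdmissibleW₀ ε R) (L : ℕ) [NeZero L] (hL : 3 ≤ L) :
    1 / 8 - ε / 2 ≤ 𝒲.bondCorr L 0 :=
  𝒲.bondCorr_lower' L hL

end Facts

/-! ## C.3 Bookkeeping over the tree (targets of this generation) -/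

section Bookkeeping

variable {ε : ℝ} {R : ℕ}

/-- `G'^α(x,y) = G'^α(y,x)`. [folklore] -/
private theorem corr_symm (𝒲 : AdmissibleW₀ ε R) (L : ℕ) [NeZero L] (α : Fin 3) (x y : TorusSite 2 L) :
    𝒲.corr L α x y = 𝒲.corr L α y x := by
  unfold AdmissibleW₀.corr
  have h : siteSpin 1 y α * siteSpin 1 x α =
      (siteSpin 1 x α * siteSpin 1 y α : Op (TorusSite 2 L) (1 + 1))ᴴ := by
    rw [conjTranspose_mul, (siteSpin_isHermitian 1 x α).eq, (siteSpin_isHermitian 1 y α).eq]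
  rw [h, groundStateFunctional_conjTranspose_re]

/-- **Sum rule (C′)** `|Λ|⁻¹ Σ_q ĝ'_q (½ Σᵢ cos qᵢ) = e'₁` (Parseval; tree `sum_structureFactor_mul_cos`). [cite: KLS1988PRL, eq. (6)] -/
theorem sumRule (𝒲 : AdmissibleW₀ ε R) (L : ℕ) [NeZero L] :
    (∑ q : TorusSite 2 L, 𝒲.sf L q * (torusCosSum L q / 2)) / (L : ℝ) ^ 2 = 𝒲.bondCorr L 0 := by
  have hL0 : (L : ℝ) ^ 2 ≠ 0 := by
    have : (L : ℝ) ≠ 0 := by exact_mod_cast NeZero.ne L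
    positivity
  simp_rw [AdmissibleW₀.sf, torusCosSum, AdmissibleW₀.bondCorr]
  have h : ∀ q : TorusSite 2 L,
      (∑ x : TorusSite 2 L, ∑ y : TorusSite 2 L,
          Real.cos (torusPhase L q (x - y)) * 𝒲.corr L 0 x y) / (L : ℝ) ^ 2 *
        ((∑ i : Fin 2, Real.cos (latticeMomentum L q i)) / 2) =
      (∑ i : Fin 2, (∑ x : TorusSite 2 L, ∑ y : TorusSite 2 L,
          Real.cos (torusPhase L q (x - y)) * 𝒲.corr L 0 x y) *
        Real.cos (latticeMomentum L q i)) / ((2 : ℝ) * (L : ℝ) ^ 2) := by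
    intro q
    rw [div_mul_div_comm, mul_sum, mul_comm ((L : ℝ) ^ 2) (2 : ℝ)]
  simp_rw [h]
  rw [← sum_div, sum_comm]
  simp_rw [sum_structureFactor_mul_cos L (𝒲.corr L 0) (corr_symm 𝒲 L 0)]
  rw [← mul_sum, sum_comm]
  field_simp

/-- `ω(A_a A_b) = Σ_{x,y} a_x b_y ω(S¹_x S¹_y)` for ANY state (tree: `groundStateFunctional_wave_mul_wave`). [folklore] -/
private theorem wave_mul_wave_state (L : ℕ) [NeZero L] (A : Op (TorusSite 2 L) (1 + 1))
    (a b : TorusSite 2 L → ℝ) :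
    A.groundStateFunctional
        ((∑ x : TorusSite 2 L, (a x : ℂ) • siteSpin 1 x 0) *
          ∑ y : TorusSite 2 L, (b y : ℂ) • siteSpin 1 y 0) =
      ∑ x : TorusSite 2 L, ∑ y : TorusSite 2 L, ((a x * b y : ℝ) : ℂ) *
        A.groundStateFunctional (siteSpin 1 x 0 * siteSpin 1 y 0) := by
  rw [sum_mul_sum, map_sum]
  refine sum_congr rfl fun x _ => ?_
  rw [map_sum]
  refine sum_congr rfl fun y _ => ?_
  rw [smul_mul_assoc, mul_smul_comm, smul_smul, LinearMap.map_smul, smul_eq_mul,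
    Complex.ofReal_mul]

/-- `|Λ| ĝ'_q = Re ω'(C_q²) + Re ω'(D_q²)` (tree: `xyStructureFactor_eq_modes`). [folklore] -/
private theorem sf_eq_modes (𝒲 : AdmissibleW₀ ε R) (L : ℕ) [NeZero L] (q : TorusSite 2 L) :
    𝒲.sf L q * (L : ℝ) ^ 2 =
      ((𝒲.H L).groundStateFunctional (xyCosMode L 1 q * xyCosMode L 1 q)).re +
        ((𝒲.H L).groundStateFunctional (xySinMode L 1 q * xySinMode L 1 q)).re := by
  have hL : (0 : ℝ) < (L : ℝ) ^ 2 := by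
    have : (0 : ℝ) < L := by exact_mod_cast Nat.pos_of_ne_zero (NeZero.ne L)
    positivity
  rw [AdmissibleW₀.sf, div_mul_cancel₀ _ hL.ne', xyCosMode, xySinMode, wave_mul_wave_state,
    wave_mul_wave_state, Complex.re_sum, Complex.re_sum, ← sum_add_distrib]
  refine sum_congr rfl fun x _ => ?_
  rw [Complex.re_sum, Complex.re_sum, ← sum_add_distrib]
  refine sum_congr rfl fun y _ => ?_
  rw [Complex.re_ofReal_mul, Complex.re_ofReal_mul, AdmissibleW₀.corr, cos_torusPhase_sub]
  ring

/-- `0 ≤ ĝ'_q`. [folklore] -/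
private theorem sf_nonneg (𝒲 : AdmissibleW₀ ε R) (L : ℕ) [NeZero L] (q : TorusSite 2 L) :
    0 ≤ 𝒲.sf L q := by
  have hL : (0 : ℝ) < (L : ℝ) ^ 2 := by
    have : (0 : ℝ) < L := by exact_mod_cast Nat.pos_of_ne_zero (NeZero.ne L)
    positivity
  have h := sf_eq_modes 𝒲 L q
  have h1 := re_groundStateFunctional_mul_self_nonneg (𝒲.H L) (xyCosMode_isHermitian L 1 q)
  have h2 := re_groundStateFunctional_mul_self_nonneg (𝒲.H L) (xySinMode_isHermitian L 1 q)
  nlinarith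

/-- The LRO sum through the structure factor at `q = 0` (uses F3c). [cite: KLS1988PRL, eq. (7)] -/
theorem lroSum_eq (𝒲 : AdmissibleW₀ ε R) (L : ℕ) [NeZero L] :
    𝒲.lroSum L = 2 * (L : ℝ) ^ 2 * 𝒲.sf L 0 := by
  have hL0 : (L : ℝ) ^ 2 ≠ 0 := by
    have : (L : ℝ) ≠ 0 := by exact_mod_cast NeZero.ne L
    positivity
  have hL : (L : ℝ) ≠ 0 := by exact_mod_cast NeZero.ne L
  have e : ∀ S : ℝ, 2 * (L : ℝ) ^ 2 * (S / (L : ℝ) ^ 2) = 2 * S := fun S => by field_simp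
  rw [AdmissibleW₀.sf, e, AdmissibleW₀.lroSum, map_sum, Complex.re_sum, mul_sum]
  refine sum_congr rfl fun x _ => ?_
  rw [map_sum, Complex.re_sum, mul_sum]
  refine sum_congr rfl fun y _ => ?_
  rw [map_add, Complex.add_re, torusPhase_zero_left, Real.cos_zero, one_mul]
  change 𝒲.corr L 0 x y + 𝒲.corr L 1 x y = 2 * 𝒲.corr L 0 x y
  rw [corr_one_eq_corr_zero]
  ring

/-- **The germ of `MeanGDn` (Part A instance, R1 bookkeeping)**: for every even `L ≥ 4` and all
multipliers `ν`, `0 ≤ Σ_{q≠0} F₂(p_q) (γ + 2ν_q ĝ'_q + ν_q² β'_q/(4E_q))`, `γ = 1 + κ`. [cite: KLS1988JSP, eq. (14)] -/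
theorem quadForm_of_meanGDn (𝒲 : AdmissibleW₀ ε R) {κ : ℝ} (hM : MeanGDn 𝒲 κ) (L : ℕ) [NeZero L]
    (hL : Even L) (h4 : 4 ≤ L) (ν : TorusSite 2 L → ℝ) :
    0 ≤ ∑ q ∈ (univ : Finset (TorusSite 2 L)).erase 0, klsIntegrand 2 (latticeMomentum L q) *
      ((1 + κ) + 2 * ν q * 𝒲.sf L q + ν q ^ 2 * 𝒲.beta L q / (4 * dispersion (latticeMomentum L q))) := by
  obtain ⟨δ, hδ, hMt⟩ := hM L hL h4
  have hH : (𝒲.H L).IsHermitian := 𝒲.H_isHermitian L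
  have hL0 : (L : ℝ) ≠ 0 := by exact_mod_cast NeZero.ne L
  have hLpos : (0 : ℝ) < (L : ℝ) ^ 2 := by positivity
  set s₀ : Finset (TorusSite 2 L) := (univ : Finset (TorusSite 2 L)).erase 0 with hs₀
  set E : TorusSite 2 L → ℝ := fun q => dispersion (latticeMomentum L q) with hE_def
  -- the family: cos-modes ⊕ sin-modes, `V = -V_h` so that `H + tV = H - V_{t h}`
  set V : TorusSite 2 L ⊕ TorusSite 2 L → Op (TorusSite 2 L) (1 + 1) :=
    Sum.elim (fun q => -xyGradField L 1 (cosWave L q)) (fun q => -xyGradField L 1 (sinWave L q))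
    with hV_def
  set w : TorusSite 2 L ⊕ TorusSite 2 L → ℝ := Sum.elim (klsWeight L) (klsWeight L) with hw_def
  set Q : TorusSite 2 L ⊕ TorusSite 2 L → ℝ :=
    Sum.elim (fun q => xyFieldEnergy L (cosWave L q)) (fun q => xyFieldEnergy L (sinWave L q))
    with hQ_def
  set μ : TorusSite 2 L ⊕ TorusSite 2 L → ℝ :=
    Sum.elim (fun q => ν q / (4 * E q)) (fun q => ν q / (4 * E q)) with hμ_def
  have hVh : ∀ i ∈ s₀.disjSum s₀, (V i).IsHermitian := by
    rintro (q | q) _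
    · exact (xyGradField_isHermitian L 1 (cosWave L q)).neg
    · exact (xyGradField_isHermitian L 1 (sinWave L q)).neg
  have hw : ∀ i ∈ s₀.disjSum s₀, 0 ≤ w i := by
    rintro (q | q) _
    · exact klsWeight_nonneg L q
    · exact klsWeight_nonneg L q
  have h1 : ∀ i ∈ s₀.disjSum s₀, ((𝒲.H L).groundStateFunctional (V i)).re = 0 := by
    rintro (q | q) hi
    · have hq : q ≠ 0 := (mem_erase.1 (Finset.inl_mem_disjSum.1 hi)).1
      show ((𝒲.H L).groundStateFunctional (-xyGradField L 1 (cosWave L q))).re = 0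
      rw [xyGradField_cosWave, map_neg, LinearMap.map_smul, smul_eq_mul, Complex.neg_re,
        Complex.re_ofReal_mul, (oneMode_centred 𝒲 L hq).1, mul_zero, neg_zero]
    · have hq : q ≠ 0 := (mem_erase.1 (Finset.inr_mem_disjSum.1 hi)).1
      show ((𝒲.H L).groundStateFunctional (-xyGradField L 1 (sinWave L q))).re = 0
      rw [xyGradField_sinWave, map_neg, LinearMap.map_smul, smul_eq_mul, Complex.neg_re,
        Complex.re_ofReal_mul, (oneMode_centred 𝒲 L hq).2, mul_zero, neg_zero]
  have key : ∀ (t : ℝ) (h : TorusSite 2 L → ℝ),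
      (𝒲.H L).groundEnergy - (𝒲.H L + (t : ℂ) • (-xyGradField L 1 h)).groundEnergy =
        𝒲.gdGain L (t • h) := by
    intro t h
    rw [AdmissibleW₀.gdGain, xyGradField_smul, smul_neg, ← sub_eq_add_neg]
  have hGD : ∃ δ > 0, ∀ t : ℝ, |t| < δ →
      ∑ i ∈ s₀.disjSum s₀, w i * ((𝒲.H L).groundEnergy -
        (𝒲.H L + (t : ℂ) • V i).groundEnergy) ≤
        (1 + κ) / 2 * t ^ 2 * ∑ i ∈ s₀.disjSum s₀, w i * Q i := by
    refine ⟨δ, hδ, fun t ht => ?_⟩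
    have hm := hMt t ht
    rw [Finset.sum_disjSum, Finset.sum_disjSum]
    simp only [hV_def, hw_def, hQ_def, Sum.elim_inl, Sum.elim_inr]
    simp_rw [key]
    rw [← sum_add_distrib, ← sum_add_distrib]
    simp_rw [← mul_add, xyFieldEnergy_smul] at hm ⊢
    calc _ ≤ _ := hm
      _ = _ := by
        rw [mul_sum, mul_sum]
        exact sum_congr rfl fun q _ => by ring
  have hA := weighted_secondOrderPT hH (s₀.disjSum s₀) hVh hw h1 hGD μ
  rw [Finset.sum_disjSum] at hA
  simp only [hV_def, hw_def, hQ_def, hμ_def, Sum.elim_inl, Sum.elim_inr] at hA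
  rw [← sum_add_distrib] at hA
  -- per-mode identity
  have hmode : ∀ q ∈ s₀,
      klsWeight L q * ((1 + κ) * xyFieldEnergy L (cosWave L q) / 2 +
        2 * (ν q / (4 * E q)) * ((𝒲.H L).groundStateFunctional
          (-xyGradField L 1 (cosWave L q) * -xyGradField L 1 (cosWave L q))).re +
        (ν q / (4 * E q)) ^ 2 * ((𝒲.H L).groundStateFunctional
          (-xyGradField L 1 (cosWave L q) * (𝒲.H L - ((𝒲.H L).groundEnergy : ℂ) • 1) *
            -xyGradField L 1 (cosWave L q))).re) +
      klsWeight L q * ((1 + κ) * xyFieldEnergy L (sinWave L q) / 2 +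
        2 * (ν q / (4 * E q)) * ((𝒲.H L).groundStateFunctional
          (-xyGradField L 1 (sinWave L q) * -xyGradField L 1 (sinWave L q))).re +
        (ν q / (4 * E q)) ^ 2 * ((𝒲.H L).groundStateFunctional
          (-xyGradField L 1 (sinWave L q) * (𝒲.H L - ((𝒲.H L).groundEnergy : ℂ) • 1) *
            -xyGradField L 1 (sinWave L q))).re) =
      (L : ℝ) ^ 2 * (klsIntegrand 2 (latticeMomentum L q) *
        ((1 + κ) + 2 * ν q * 𝒲.sf L q + ν q ^ 2 * 𝒲.beta L q / (4 * E q))) := by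
    intro q hq
    have hq0 : q ≠ 0 := (mem_erase.1 hq).1
    have hE : 0 < E q := dispersion_latticeMomentum_pos hq0
    -- the fields are multiples of the modes
    have e2 : ∀ (a : ℂ) (C : Op (TorusSite 2 L) (1 + 1)), -(a • C) * -(a • C) = (a * a) • (C * C) := by
      intro a C
      simp only [neg_mul, mul_neg, smul_neg, neg_neg, smul_mul_assoc, mul_smul_comm, smul_smul]
    have e3 : ∀ (a : ℂ) (C K : Op (TorusSite 2 L) (1 + 1)),
        -(a • C) * K * -(a • C) = (a * a) • (C * K * C) := by
      intro a C K
      simp only [neg_mul, mul_neg, smul_neg, neg_neg, smul_mul_assoc, mul_smul_comm, smul_smul,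
        mul_assoc]
    rw [xyGradField_cosWave, xyGradField_sinWave, e2, e2, e3, e3]
    simp only [LinearMap.map_smul, smul_eq_mul, ← Complex.ofReal_mul, Complex.re_ofReal_mul]
    -- the scalar facts
    have hQ := xyFieldEnergy_cosWave_add_sinWave L q
    have hsf := sf_eq_modes 𝒲 L q
    have hβ : 𝒲.beta L q * (L : ℝ) ^ 2 =
        ((𝒲.H L).groundStateFunctional (xyCosMode L 1 q *
          (𝒲.H L - ((𝒲.H L).groundEnergy : ℂ) • 1) * xyCosMode L 1 q)).re +
        ((𝒲.H L).groundStateFunctional (xySinMode L 1 q *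
          (𝒲.H L - ((𝒲.H L).groundEnergy : ℂ) • 1) * xySinMode L 1 q)).re := by
      rw [AdmissibleW₀.beta, div_mul_cancel₀ _ hLpos.ne']
    have hF : klsIntegrand 2 (latticeMomentum L q) = klsWeight L q * E q := by
      rw [klsWeight, hE_def, div_mul_cancel₀ _ hE.ne']
    -- eliminate the sine quantities and the KLS weight
    set A := ((𝒲.H L).groundStateFunctional (xyCosMode L 1 q * xyCosMode L 1 q)).re
    set B := ((𝒲.H L).groundStateFunctional (xySinMode L 1 q * xySinMode L 1 q)).re
    set A' := ((𝒲.H L).groundStateFunctional (xyCosMode L 1 q *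
      (𝒲.H L - ((𝒲.H L).groundEnergy : ℂ) • 1) * xyCosMode L 1 q)).re
    set B' := ((𝒲.H L).groundStateFunctional (xySinMode L 1 q *
      (𝒲.H L - ((𝒲.H L).groundEnergy : ℂ) • 1) * xySinMode L 1 q)).re
    set Qc := xyFieldEnergy L (cosWave L q)
    set Qs := xyFieldEnergy L (sinWave L q)
    have hB : B = 𝒲.sf L q * (L : ℝ) ^ 2 - A := by linarith
    have hB' : B' = 𝒲.beta L q * (L : ℝ) ^ 2 - A' := by linarith
    have hQs : Qs = 2 * E q * (L : ℝ) ^ 2 - Qc := by rw [hE_def]; linarith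
    rw [hB, hB', hQs, hF]
    field_simp
    ring
  rw [sum_congr rfl hmode, ← mul_sum] at hA
  exact (mul_nonneg_iff_of_pos_left hLpos).1 hA

/-- **β′ bound** on the KLS support: for `q ≠ 0` with `Σᵢ cos qᵢ > 0`,
`β'_q ≤ ẽ (2 + Σᵢ cos qᵢ)`, `ẽ = e'₁ + (1 + R⁴/2) ε` (F3a–F3e). [cite: KLS1988JSP, eq. (13)] -/
theorem beta_le (𝒲 : AdmissibleWsym ε R) (hε : 0 ≤ ε) (k : ℕ) (hk : 2 ≤ k) [NeZero (2 * k)]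
    (q : TorusSite 2 (2 * k)) (hC : 0 < torusCosSum (2 * k) q) :
    𝒲.toAdmissibleW₀.beta (2 * k) q ≤
      (𝒲.toAdmissibleW₀.bondCorr (2 * k) 0 + (1 + (R : ℝ) ^ 4 / 2) * ε) *
        (2 + torusCosSum (2 * k) q) := by
  set 𝒲₀ := 𝒲.toAdmissibleW₀ with h𝒲₀
  have hL3 : 3 ≤ 2 * k := by omega
  have hLpos : (0 : ℝ) < ((2 * k : ℕ) : ℝ) ^ 2 := by positivity
  set H := 𝒲₀.H (2 * k) with hH_def
  have hH : H.IsHermitian := 𝒲₀.H_isHermitian (2 * k)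
  set Cq : Op (TorusSite 2 (2 * k)) (1 + 1) := xyCosMode (2 * k) 1 q with hCq
  set Dq : Op (TorusSite 2 (2 * k)) (1 + 1) := xySinMode (2 * k) 1 q with hDq
  set e₁ := 𝒲₀.bondCorr (2 * k) 0 with he₁
  set e₃ := 𝒲₀.bondCorr (2 * k) 2 with he₃
  set Cs := torusCosSum (2 * k) q with hCs
  -- Step 1: `ω(V K V) = ½ ω([V,[H,V]])`
  have hlie : ∀ V : Op (TorusSite 2 (2 * k)) (1 + 1),
      (H.groundStateFunctional (V * (H - (H.groundEnergy : ℂ) • 1) * V)).re =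
        1 / 2 * (H.groundStateFunctional ⁅V, ⁅H, V⁆⁆).re := by
    intro V
    rw [groundStateFunctional_mul_sub_groundEnergy_mul hH V]
    have e : V * (H * V) - V * (V * H) - (H * V * V - V * (H * V)) = ⁅V, ⁅H, V⁆⁆ := by
      simp only [Ring.lie_def, mul_sub, sub_mul, mul_assoc]
    rw [e, show (1 / 2 : ℂ) = ((1 / 2 : ℝ) : ℂ) by push_cast; ring, Complex.re_ofReal_mul]
  have hβ : 𝒲₀.beta (2 * k) q * ((2 * k : ℕ) : ℝ) ^ 2 =
      1 / 2 * ((H.groundStateFunctional ⁅Cq, ⁅H, Cq⁆⁆).re +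
        (H.groundStateFunctional ⁅Dq, ⁅H, Dq⁆⁆).re) := by
    rw [AdmissibleW₀.beta, div_mul_cancel₀ _ hLpos.ne', ← hH_def, ← hCq, ← hDq, hlie, hlie]
    ring
  -- Step 2: `H' = H + W`
  have hsplit : ∀ V : Op (TorusSite 2 (2 * k)) (1 + 1),
      ⁅V, ⁅H, V⁆⁆ = ⁅V, ⁅xyTorus 2 (2 * k) 1, V⁆⁆ + ⁅V, ⁅𝒲₀.W (2 * k), V⁆⁆ := by
    intro V
    rw [hH_def, AdmissibleW₀.H]
    simp only [Ring.lie_def, mul_add, add_mul, mul_sub, sub_mul]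
    abel
  -- Step 3: the two double commutators
  have h3a := re_lie_lie_modes_state (2 * k) hL3 H q
  have h3b := (abs_le.1 (re_lie_lie_W_abs_le 𝒲₀ hε (2 * k) q)).2
  rw [← hH_def, ← hCq, ← hDq] at h3b
  rw [← hCq, ← hDq] at h3a
  -- Step 4: the bond sums
  have hc1 : ∀ (i : Fin 2) (z : TorusSite 2 (2 * k)),
      (H.groundStateFunctional (siteSpin 1 z 1 * siteSpin 1 (z + Pi.single i 1) 1)).re =
        𝒲₀.corr (2 * k) 0 z (z + Pi.single i 1) := fun i z =>
    corr_one_eq_corr_zero 𝒲₀ (2 * k) z _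
  have hc2 : ∀ (i : Fin 2) (z : TorusSite 2 (2 * k)),
      (H.groundStateFunctional (siteSpin 1 z 2 * siteSpin 1 (z + Pi.single i 1) 2)).re =
        𝒲₀.corr (2 * k) 2 z (z + Pi.single i 1) := fun i z => rfl
  simp_rw [hc1, hc2] at h3a
  have hG1 : ∑ i : Fin 2, ∑ z : TorusSite 2 (2 * k), 𝒲₀.corr (2 * k) 0 z (z + Pi.single i 1) =
      2 * ((2 * k : ℕ) : ℝ) ^ 2 * e₁ := by
    rw [he₁, AdmissibleW₀.bondCorr, sum_comm]
    field_simp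
  have hdir := bond_dir_symm 𝒲 (2 * k) 2
  rw [← h𝒲₀] at hdir
  have hBsum : ∑ z : TorusSite 2 (2 * k), 𝒲₀.corr (2 * k) 2 z (z + Pi.single 0 1) =
      ((2 * k : ℕ) : ℝ) ^ 2 * e₃ := by
    have h2 : ∑ z : TorusSite 2 (2 * k), ∑ i : Fin 2, 𝒲₀.corr (2 * k) 2 z (z + Pi.single i 1) =
        2 * ((2 * k : ℕ) : ℝ) ^ 2 * e₃ := by
      rw [he₃, AdmissibleW₀.bondCorr]
      field_simp
    simp_rw [Fin.sum_univ_two] at h2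
    rw [sum_add_distrib, ← hdir] at h2
    linarith
  have hG2 : ∑ i : Fin 2, ∑ z : TorusSite 2 (2 * k),
      Real.cos (latticeMomentum (2 * k) q i) * 𝒲₀.corr (2 * k) 2 z (z + Pi.single i 1) =
      Cs * (((2 * k : ℕ) : ℝ) ^ 2 * e₃) := by
    simp_rw [← mul_sum]
    rw [Fin.sum_univ_two, ← hdir, hBsum, hCs, torusCosSum, Fin.sum_univ_two]
    ring
  have h3a' : (H.groundStateFunctional ⁅Cq, ⁅xyTorus 2 (2 * k) 1, Cq⁆⁆).re +
      (H.groundStateFunctional ⁅Dq, ⁅xyTorus 2 (2 * k) 1, Dq⁆⁆).re =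
      2 * (2 * ((2 * k : ℕ) : ℝ) ^ 2 * e₁ - Cs * (((2 * k : ℕ) : ℝ) ^ 2 * e₃)) := by
    rw [h3a]
    simp only [sum_sub_distrib]
    rw [hG1, hG2]
  -- Step 5: Kubo and the arithmetic
  have hK := kubo_state 𝒲₀ hε k (by omega)
  rw [← he₁, ← he₃] at hK
  have hK' : -e₃ ≤ e₁ + ε := (neg_le_abs e₃).trans hK
  have hmain : 𝒲₀.beta (2 * k) q * ((2 * k : ℕ) : ℝ) ^ 2 ≤
      ((2 * k : ℕ) : ℝ) ^ 2 * (2 * e₁ - Cs * e₃ + (R : ℝ) ^ 4 * ε) := by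
    rw [hβ, hsplit, hsplit, map_add, map_add, Complex.add_re, Complex.add_re]
    nlinarith [h3a', h3b]
  have hfin : ((2 * k : ℕ) : ℝ) ^ 2 * (2 * e₁ - Cs * e₃ + (R : ℝ) ^ 4 * ε) ≤
      (e₁ + (1 + (R : ℝ) ^ 4 / 2) * ε) * (2 + Cs) * ((2 * k : ℕ) : ℝ) ^ 2 := by
    have h1 : -(Cs * e₃) ≤ Cs * (e₁ + ε) := by nlinarith
    have h2 : 0 ≤ (R : ℝ) ^ 4 * ε * Cs := by positivity
    have h3 : 0 ≤ ε := hε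
    nlinarith
  exact le_of_mul_le_mul_right (hmain.trans hfin) hLpos

/-- **KLS eq. (7)′**: `e'₁ ≤ ĝ'₀/|Λ| + ½ √(ẽ (1+κ)) R_L` on even tori `L = 2k ≥ 4`. [cite: KLS1988PRL, eq. (7)] -/
theorem kls_ineq7_state (𝒲 : AdmissibleWsym ε R) (hε : 0 ≤ ε) {κ : ℝ} (hκ : 0 ≤ κ)
    (hM : MeanGDn 𝒲.toAdmissibleW₀ κ) (k : ℕ) (hk : 2 ≤ k) [NeZero (2 * k)]
    (he : 0 < 𝒲.toAdmissibleW₀.bondCorr (2 * k) 0 + (1 + (R : ℝ) ^ 4 / 2) * ε) :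
    𝒲.toAdmissibleW₀.bondCorr (2 * k) 0 ≤
      𝒲.toAdmissibleW₀.sf (2 * k) 0 / ((2 * k : ℕ) : ℝ) ^ 2 +
        1 / 2 * Real.sqrt ((𝒲.toAdmissibleW₀.bondCorr (2 * k) 0 + (1 + (R : ℝ) ^ 4 / 2) * ε) *
          (1 + κ)) * klsRiemannSum 2 (2 * k) := by
  have hL : (0 : ℝ) < ((2 * k : ℕ) : ℝ) ^ 2 := by positivity
  set 𝒲₀ := 𝒲.toAdmissibleW₀ with h𝒲₀
  set e₁ := 𝒲₀.bondCorr (2 * k) 0 with he₁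
  set ee := e₁ + (1 + (R : ℝ) ^ 4 / 2) * ε with hee
  -- Part B on the punctured zone
  have hB : ∑ q ∈ (univ : Finset (TorusSite 2 (2 * k))).erase 0,
      𝒲₀.sf (2 * k) q * (torusCosSum (2 * k) q / 2) ≤
      1 / 2 * Real.sqrt (ee * (1 + κ)) *
        ∑ q ∈ (univ : Finset (TorusSite 2 (2 * k))).erase 0,
          klsIntegrand 2 (latticeMomentum (2 * k) q) := by
    refine kls_modeSum_le_of_quadForm ((univ : Finset (TorusSite 2 (2 * k))).erase 0)
      (F := fun q => klsIntegrand 2 (latticeMomentum (2 * k) q))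
      (g := fun q => 𝒲₀.sf (2 * k) q) (C := fun q => torusCosSum (2 * k) q)
      (E := fun q => dispersion (latticeMomentum (2 * k) q)) (β := fun q => 𝒲₀.beta (2 * k) q)
      (d := 2) (e := ee) (γ := 1 + κ) two_pos he (by linarith) ?_ ?_ ?_ ?_ ?_
    · exact fun q hq => dispersion_latticeMomentum_pos (mem_erase.1 hq).1
    · exact fun q _ => sf_nonneg 𝒲₀ (2 * k) q
    · intro q _
      rw [klsIntegrand_latticeMomentum]
      push_cast
      rfl
    · intro q _ hC
      exact beta_le 𝒲 hε k hk q hC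
    · intro ν
      exact quadForm_of_meanGDn 𝒲₀ hM (2 * k) ⟨k, by ring⟩ (by omega) ν
  -- add the zero mode and use the sum rule
  have hsum : ∑ q : TorusSite 2 (2 * k), 𝒲₀.sf (2 * k) q * (torusCosSum (2 * k) q / 2) ≤
      𝒲₀.sf (2 * k) 0 + 1 / 2 * Real.sqrt (ee * (1 + κ)) *
        ∑ q ∈ (univ : Finset (TorusSite 2 (2 * k))).erase 0,
          klsIntegrand 2 (latticeMomentum (2 * k) q) := by
    rw [← add_sum_erase _ _ (mem_univ (0 : TorusSite 2 (2 * k))), torusCosSum_zero]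
    push_cast
    rw [div_self two_ne_zero, mul_one]
    exact add_le_add le_rfl hB
  have hC := sumRule 𝒲₀ (2 * k)
  rw [klsRiemannSum_of_neZero]
  calc e₁ = (∑ q : TorusSite 2 (2 * k), 𝒲₀.sf (2 * k) q *
          (torusCosSum (2 * k) q / 2)) / ((2 * k : ℕ) : ℝ) ^ 2 := hC.symm
    _ ≤ (𝒲₀.sf (2 * k) 0 + 1 / 2 * Real.sqrt (ee * (1 + κ)) *
          ∑ q ∈ (univ : Finset (TorusSite 2 (2 * k))).erase 0,
            klsIntegrand 2 (latticeMomentum (2 * k) q)) / ((2 * k : ℕ) : ℝ) ^ 2 :=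
        div_le_div_of_nonneg_right hsum hL.le
    _ = _ := by rw [add_div, mul_div_assoc]

/-- `0 ≤ I(2)` (limit of nonnegative Riemann sums; tree (R)). [folklore] -/
private theorem klsIntegral_two_nonneg : 0 ≤ klsIntegral 2 :=
  ge_of_tendsto' (klsRiemannSum_tendsto_holds 2 le_rfl) fun L => klsRiemannSum_nonneg 2 L

set_option maxHeartbeats 1600000 in
/-- **The KLS transfer at the threshold `klsKappa₀` (unconditional).** [cite: KLS1988JSP, eqs. (12)–(14)] [cite: KLS1988PRL, eqs. (3)–(8)] -/
theorem klsTransferJn : KLSTransferJnAt klsKappa₀ := by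
  intro κ hκ0 hκ R
  -- Step 0: the numerical constants
  set γ : ℝ := 1 + κ with hγ_def
  have hγ1 : 1 ≤ γ := by linarith
  have hγ0 : 0 < γ := by linarith
  set I : ℝ := klsIntegral 2 with hI_def
  have hI0 : 0 ≤ I := klsIntegral_two_nonneg
  have hκ' : κ < 1 / (2 * I ^ 2) - 1 := hκ
  have hIpos : 0 < I := by
    rcases hI0.eq_or_lt with h | h
    · exfalso; rw [← h] at hκ'; norm_num at hκ'; linarith
    · exact h
  -- `2 I² γ < 1`
  have h2I : 2 * I ^ 2 * γ < 1 := by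
    have h1 : γ < 1 / (2 * I ^ 2) := by linarith
    have h2 : 0 < 2 * I ^ 2 := by positivity
    calc 2 * I ^ 2 * γ < 2 * I ^ 2 * (1 / (2 * I ^ 2)) := mul_lt_mul_of_pos_left h1 h2
      _ = 1 := by field_simp
  -- `ρ̄` strictly between `I` and `1/√(2γ)`; `θ = 2 ρ̄² γ < 1`
  set r : ℝ := 1 / Real.sqrt (2 * γ) with hr_def
  have hr0 : 0 < r := by positivity
  have hr2 : 2 * r ^ 2 * γ = 1 := by
    rw [hr_def, div_pow, Real.sq_sqrt (by positivity)]
    field_simp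
  have hIr : I < r := by
    by_contra h
    push Not at h
    have h' : r ^ 2 ≤ I ^ 2 := pow_le_pow_left₀ hr0.le h 2
    have h'' : 2 * r ^ 2 * γ ≤ 2 * I ^ 2 * γ :=
      mul_le_mul_of_nonneg_right (by linarith) hγ0.le
    linarith
  set ρ : ℝ := (I + r) / 2 with hρ_def
  have hIρ : I < ρ := by rw [hρ_def]; linarith
  have hρr : ρ < r := by rw [hρ_def]; linarith
  have hρ0 : 0 < ρ := hIpos.trans hIρ
  set θ : ℝ := 2 * ρ ^ 2 * γ with hθ_def
  have hθ1 : θ < 1 := by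
    have h' : ρ ^ 2 < r ^ 2 := pow_lt_pow_left₀ hρr hρ0.le two_ne_zero
    rw [hθ_def, ← hr2]
    have h'' : 2 * ρ ^ 2 * γ < 2 * r ^ 2 * γ := mul_lt_mul_of_pos_right (by linarith) hγ0
    exact h''
  have hθ0 : 0 < θ := by positivity
  -- the strength `ε₀`, the floor `s₀`, the shift `η`, the constant `c`
  set a : ℝ := 1 + (R : ℝ) ^ 4 / 2 with ha_def
  have ha1 : 1 ≤ a := by have : (0 : ℝ) ≤ (R : ℝ) ^ 4 / 2 := by positivity
                         linarith
  set ε₀ : ℝ := (1 - θ) / (16 * (1 + a)) with hε₀_def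
  have hε₀ : 0 < ε₀ := by rw [hε₀_def]; exact div_pos (by linarith) (by positivity)
  have hε₀' : ε₀ ≤ 1 / 16 := by
    rw [hε₀_def, div_le_div_iff₀ (by positivity) (by norm_num)]
    have : (1 - θ) * 16 ≤ 1 * 16 := by nlinarith
    nlinarith
  set s₀ : ℝ := 1 / 8 - ε₀ / 2 with hs₀_def
  set η : ℝ := a * ε₀ with hη_def
  have hη0 : 0 ≤ η := by positivity
  have hs₀0 : 1 / 16 < s₀ := by rw [hs₀_def]; linarith
  have hsη : 1 / 16 ≤ s₀ + η := by linarith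
  -- `c > 0`: `4 s₀² > ρ² γ (s₀ + η) = (θ/2)(s₀ + η)`
  have hkey : ρ ^ 2 * γ * (s₀ + η) < 4 * s₀ ^ 2 := by
    have e1 : ρ ^ 2 * γ * (s₀ + η) = θ / 2 * (s₀ + η) := by rw [hθ_def]; ring
    rw [e1]
    have h1 : 4 * s₀ ^ 2 ≥ 1 / 16 - ε₀ / 2 := by
      rw [hs₀_def]
      have : 4 * (1 / 8 - ε₀ / 2) ^ 2 = 1 / 16 - ε₀ / 2 + ε₀ ^ 2 := by ring
      rw [this]
      nlinarith [sq_nonneg ε₀]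
    have h2 : θ / 2 * (s₀ + η) ≤ θ / 16 + a * ε₀ / 2 := by
      have : s₀ + η ≤ 1 / 8 + a * ε₀ := by rw [hs₀_def, hη_def]; linarith
      calc θ / 2 * (s₀ + η) ≤ θ / 2 * (1 / 8 + a * ε₀) :=
            mul_le_mul_of_nonneg_left this (by positivity)
        _ = θ / 16 + θ * (a * ε₀ / 2) := by ring
        _ ≤ θ / 16 + 1 * (a * ε₀ / 2) := by
            have : 0 ≤ a * ε₀ / 2 := by positivity
            nlinarith
        _ = θ / 16 + a * ε₀ / 2 := by ring
    have h3 : (1 + a) * ε₀ / 2 < (1 - θ) / 16 := by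
      rw [hε₀_def]
      have : (1 + a) * ((1 - θ) / (16 * (1 + a))) / 2 = (1 - θ) / 32 := by
        field_simp
        ring
      rw [this]
      linarith
    linarith
  set c : ℝ := 2 * (s₀ - 1 / 2 * Real.sqrt ((s₀ + η) * γ) * ρ) with hc_def
  have hc : 0 < c := by
    rw [hc_def]
    have h1 : Real.sqrt ((s₀ + η) * γ) * ρ < 2 * s₀ := by
      have h2 : (Real.sqrt ((s₀ + η) * γ) * ρ) ^ 2 < (2 * s₀) ^ 2 := by
        rw [mul_pow, Real.sq_sqrt (by positivity)]
        linarith [hkey]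
      exact abs_lt_of_sq_lt_sq' h2 (by positivity) |>.2
    linarith
  -- Step 1: eventually `R_L ≤ ρ`
  have hev : ∀ᶠ L : ℕ in atTop, klsRiemannSum 2 L < ρ :=
    (klsRiemannSum_tendsto_holds 2 le_rfl).eventually_lt_const hIρ
  obtain ⟨N, hN⟩ := eventually_atTop.1 hev
  refine ⟨ε₀, hε₀, c, hc, max N 4, fun 𝒲 hM => ?_⟩
  -- Step 2: the chain on the torus of even side `L ≥ max N 4`
  intro L _ hLeven hL
  have hL4 : 4 ≤ L := le_of_max_le_right hL
  have hLN : N ≤ L := le_of_max_le_left hL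
  obtain ⟨k, hk⟩ := hLeven
  have hk2 : 2 ≤ k := by omega
  have hLk : L = 2 * k := by omega
  subst hLk
  set 𝒲₀ := 𝒲.toAdmissibleW₀ with h𝒲₀
  have hLpos : (0 : ℝ) < ((2 * k : ℕ) : ℝ) ^ 2 := by positivity
  -- (D′)
  have hD : s₀ ≤ 𝒲₀.bondCorr (2 * k) 0 := by
    have := bondCorr_lower 𝒲₀ (2 * k) (by omega)
    rw [hs₀_def]; exact this
  set e₁ := 𝒲₀.bondCorr (2 * k) 0 with he₁
  have hee : 0 < e₁ + (1 + (R : ℝ) ^ 4 / 2) * ε₀ := by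
    have : (0 : ℝ) ≤ (1 + (R : ℝ) ^ 4 / 2) * ε₀ := by positivity
    linarith
  -- (7′)
  have h7 := kls_ineq7_state 𝒲 hε₀.le hκ0 hM k hk2 hee
  rw [← he₁] at h7
  have hRle : klsRiemannSum 2 (2 * k) ≤ ρ := (hN (2 * k) (by omega)).le
  have hR0 : 0 ≤ klsRiemannSum 2 (2 * k) := klsRiemannSum_nonneg _ _
  -- monotone step in `e₁` (with the shift `η = a ε₀`)
  have heq : e₁ + (1 + (R : ℝ) ^ 4 / 2) * ε₀ = e₁ + η := by rw [hη_def, ha_def]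
  rw [heq] at h7
  have hsplit : ∀ x : ℝ, 0 ≤ x → Real.sqrt (x * γ) = Real.sqrt x * Real.sqrt γ := fun x hx =>
    Real.sqrt_mul hx γ
  have hR4 : Real.sqrt γ * klsRiemannSum 2 (2 * k) ≤ 4 * Real.sqrt (s₀ + η) := by
    -- `√γ R ≤ √γ ρ = √(θ/2) < 1 ≤ 4 √(1/16) ≤ 4 √(s₀ + η)`
    have h1 : Real.sqrt γ * klsRiemannSum 2 (2 * k) ≤ Real.sqrt γ * ρ :=
      mul_le_mul_of_nonneg_left hRle (Real.sqrt_nonneg _)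
    have h2 : Real.sqrt γ * ρ ≤ 1 := by
      have hθ1' : 2 * ρ ^ 2 * γ < 1 := hθ1
      have : (Real.sqrt γ * ρ) ^ 2 ≤ 1 := by
        rw [mul_pow, Real.sq_sqrt hγ0.le]; linarith
      exact (pow_le_one_iff_of_nonneg (by positivity) two_ne_zero).1 this
    have h3 : (1 : ℝ) ≤ 4 * Real.sqrt (s₀ + η) := by
      have : Real.sqrt (1 / 16) ≤ Real.sqrt (s₀ + η) := Real.sqrt_le_sqrt hsη
      have h16 : Real.sqrt (1 / 16) = 1 / 4 := by
        rw [show (1 / 16 : ℝ) = (1 / 4) ^ 2 by norm_num, Real.sqrt_sq (by norm_num)]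
      linarith
    linarith
  have hmono := kls_monotone_step_shift (s := s₀) (e := e₁) (η := η)
    (R' := Real.sqrt γ * klsRiemannSum 2 (2 * k)) (by linarith) hD hR4
  -- Step 3: conclude
  rw [lroSum_eq]
  have hsf : s₀ - 1 / 2 * Real.sqrt ((s₀ + η) * γ) * ρ ≤
      𝒲₀.sf (2 * k) 0 / ((2 * k : ℕ) : ℝ) ^ 2 := by
    have h1 : s₀ - 1 / 2 * Real.sqrt ((s₀ + η) * γ) * ρ ≤
        s₀ - 1 / 2 * Real.sqrt ((s₀ + η) * γ) * klsRiemannSum 2 (2 * k) := by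
      have : 0 ≤ Real.sqrt ((s₀ + η) * γ) := Real.sqrt_nonneg _
      nlinarith
    have h2 : s₀ - 1 / 2 * Real.sqrt ((s₀ + η) * γ) * klsRiemannSum 2 (2 * k) ≤
        e₁ - 1 / 2 * Real.sqrt ((e₁ + η) * γ) * klsRiemannSum 2 (2 * k) := by
      rw [hsplit _ (by linarith), hsplit _ (by linarith)]
      have e : ∀ x : ℝ, x - 1 / 2 * (Real.sqrt (x + η) * Real.sqrt γ) * klsRiemannSum 2 (2 * k) =
          x - 1 / 2 * Real.sqrt (x + η) * (Real.sqrt γ * klsRiemannSum 2 (2 * k)) := fun x => by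
        ring
      rw [e, e]
      exact hmono
    linarith
  have : c * ((2 * k : ℕ) : ℝ) ^ 4 =
      2 * ((2 * k : ℕ) : ℝ) ^ 2 * ((s₀ - 1 / 2 * Real.sqrt ((s₀ + η) * γ) * ρ) *
        ((2 * k : ℕ) : ℝ) ^ 2) := by rw [hc_def]; ring
  rw [this]
  refine mul_le_mul_of_nonneg_left ?_ (by positivity)
  rwa [← le_div_iff₀ hLpos]

/-- Hence: the ONE open crux below `κ₀` gives E\*ᵀ. [cite: KLS1988JSP, eqs. (12)–(14)] [cite: KLS1988PRL, eqs. (3)–(8)] -/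
theorem tracialLRO_of_uniformMeanGDn {κ : ℝ} (hκ0 : 0 ≤ κ) (hκ : κ < klsKappa₀)
    (hU : UniformMeanGDn κ) :
    ∀ R : ℕ, ∃ ε₀ > 0, ∃ c > 0, ∃ L₀ : ℕ, ∀ 𝒲 : AdmissibleWsym ε₀ R,
    TracialLRO 𝒲.toAdmissibleW₀ c L₀ :=
  tracialLRO_of_klsTransferAt hκ0 hκ hU klsTransferJn

end Bookkeeping

end Literature.MathematicalPhysics.QuantumLattice.XYStabilityTransfer

end
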